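import Literature.NumberTheory.LFunctions.ConreyIwaniec2002AFEWeights
import Literature.NumberTheory.LFunctions.ConreyIwaniec2002Prop81Decomposition
import Literature.NumberTheory.LFunctions.ConreyIwaniec2002Prop81TailIntegral
import Literature.NumberTheory.LFunctions.ConreyIwaniec2002TailCutoff
import Literature.NumberTheory.LFunctions.WeightedDiscreteMeanValueSeries
import Literature.NumberTheory.LFunctions.ConreyIwaniec2002Corollary63Large
import Literature.NumberTheory.LFunctions.ConreyIwaniec2002LOneTrivialLowerBound
import Literature.NumberTheory.LFunctions.ConreyIwaniec2002Prop91Inputs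
import HarnessLib

/-!
# Conrey–Iwaniec (2002), §8 (8.5)–(8.9): the six range-by-range mean squares

B. Conrey, H. Iwaniec, *Spacing of zeros of Hecke L-functions and the class number problem*,
Acta Arith. 103 (2002), §8 (8.5)–(8.9) [held text `paper:arxiv-math_0111012`, p0018].

For `1`-spaced points `s = ½ + it`, `T < t ≤ 2T` (`T ≥ q^66`, `T ≥ e^{(log q)²}`) with companions
`s′ = ½ + it′`, `0 < |t − t′| ≤ 1`, §8 bounds `Σ_s |B(s)|²` (`B = (A(s) − A(s′))/(s − s′)`, (8.5)) and
`(log T)² Σ_s |A(s) − N(s)|²` ((8.8)–(8.9)) by `T(log q)^7 + T ℒ(T)(log T)^4`, range by range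
(`n ≤ q⁴`, `q⁴ < n < 2T`, `n > T`). This file proves the SIX range estimates, each in the shape
delivered by the decomposition `ConreyIwaniec2002Prop81Decomposition` and consumed from the
weighted mean-value theorems (`WeightedMeanValue.weighted_discreteMeanValue`, Lemma 5.3 with
point-dependent weights; `…_integral_tsum`, Proposition 5.4) with the admissibility constants of
`ConreyIwaniec2002AFEWeights`:
* `range1_B_le` (`c ≪ (log q)³`, `Σ_{n≤q⁴}|λ(n)|²/n ≤ (1 + 4 log q)⁴`) `≪ T(log q)^7`;
* `range2_B_le` (`c ≪ (log T)³`, Corollary 6.3 in the large range `X = q⁴+1`, `Y = 2T`)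
  `≪ Tℒ(T)(log T)^4`;
* `range3_B_le` (`c ≪ (log T)² log q`, Proposition 6.4 = binder `h64` on three windows, the
  divisor second moment `hdiv` = S6b for the error of Proposition 5.4) `≪ T(log q)^7 + Tℒ(T)(log T)^4`;
* `range1_A_le`, `range2_A_le`, `range3_A_le` — the same for `A − N` with the factor `(log T)²`
  ((8.9): `V_s(n/Q) = 1 + O((n/QT)^{1/4})` on `n ≤ q⁴`).
Numerical side conditions are collected in `prop81_numerics`. Everything PROVED; no definition.

«The programme SEARCHES and TYPES; no claim about Landau–Siegel zeros until a kernel theorem says so.»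

## References
* [ConreyIwaniec2002] B. Conrey, H. Iwaniec, Acta Arith. 103 (2002) 259–312, arXiv:math/0111012:
  §8 (8.5)–(8.9); Lemma 5.3, Proposition 5.4, Corollary 6.3, Proposition 6.4.
-/

noncomputable section

open scoped NumberField
open Complex MeasureTheory

namespace Literature.NumberTheory.LFunctions

namespace ConreyIwaniec2002

open NumberField Real

/-! ## §0. Numerics of the range `T ≥ q^66`, `T ≥ e^{(log q)²}` -/

/-- `(log T)^k ≤ 8^k T^{k/8}` (`T ≥ 1`), from `log T ≤ 8 T^{1/8}`. [cite: ConreyIwaniec2002, §8 p. 18] -/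
theorem log_pow_le_rpow {T : ℝ} (hT : 1 ≤ T) (k : ℕ) :
    Real.log T ^ k ≤ 8 ^ k * T ^ ((k : ℝ) / 8) := by
  have h1 : Real.log T ≤ 8 * T ^ ((1 : ℝ) / 8) := by
    have h := Real.log_le_rpow_div (by linarith : (0 : ℝ) ≤ T) (by norm_num : (0 : ℝ) < 1 / 8)
    linarith [show T ^ ((1 : ℝ) / 8) / (1 / 8) = 8 * T ^ ((1 : ℝ) / 8) by ring]
  have h0 : 0 ≤ Real.log T := Real.log_nonneg hT
  calc Real.log T ^ k ≤ (8 * T ^ ((1 : ℝ) / 8)) ^ k := pow_le_pow_left₀ h0 h1 k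
    _ = 8 ^ k * T ^ ((k : ℝ) / 8) := by
        rw [mul_pow, ← Real.rpow_natCast (T ^ ((1 : ℝ) / 8)) k, ← Real.rpow_mul (by linarith)]
        ring_nf

/-- **Numerics of §8**: `q > 4`, `T ≥ q^66`, `T ≥ e^{(log q)²}` give `log q ≥ 1`, `(log q)² ≤ log T`,
`log T ≥ 1`, `q⁴ + 1 ≤ T`, `2q^65 ≤ T`, `T ≥ 3`, `Q(2T+2) ≤ qT`, `q(log T)^7 ≤ 8^7 T`,
`q² T^{−1/2}(log T)² ≤ 64`, `log ⌊2T⌋ ≤ log T + 1`. [cite: ConreyIwaniec2002, §8 p. 18] -/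
theorem prop81_numerics {q : ℕ} (hq : 4 < q) {T : ℝ} (hT : (q : ℝ) ^ (66 : ℕ) ≤ T)
    (hexpT : Real.exp (Real.log q ^ (2 : ℕ)) ≤ T) :
    1 ≤ Real.log q ∧ Real.log q ^ 2 ≤ Real.log T ∧ 1 ≤ Real.log T ∧ Real.log q ≤ Real.log T ∧
    ((q ^ 4 : ℕ) : ℝ) + 1 ≤ T ∧ 2 * (q : ℝ) ^ (65 : ℕ) ≤ T ∧ 3 ≤ T ∧
    condQ q * (2 * T + 2) ≤ q * T ∧ (q : ℝ) * Real.log T ^ 7 ≤ 8 ^ 7 * T ∧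
    (q : ℝ) ^ 2 * T ^ (-(1 / 2 : ℝ)) * Real.log T ^ 2 ≤ 64 ∧
    Real.log ((⌊2 * T⌋₊ : ℕ) : ℝ) ≤ Real.log T + 1 ∧ (q : ℝ) ≤ T := by
  have hq5 : (5 : ℝ) ≤ q := by exact_mod_cast hq
  have hq1 : (1 : ℝ) ≤ q := by linarith
  have hq0 : (0 : ℝ) < q := by linarith
  have h65 : (q : ℝ) ^ (65 : ℕ) ≤ T := by
    have : (q : ℝ) ^ (65 : ℕ) ≤ (q : ℝ) ^ (66 : ℕ) := pow_le_pow_right₀ hq1 (by norm_num)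
    linarith
  obtain ⟨hℓ1, hℓLT, hq4T, hqT, hT0, hℓ_le, hLT1⟩ := range_numerics hq h65 hexpT
  have hT1 : 1 ≤ T := hq1.trans hqT
  -- `q⁴ + 1 ≤ T` and `2 q^65 ≤ T` from `q^66 = q · q^65 ≥ 5 q^65`
  have h66 : (q : ℝ) ^ (66 : ℕ) = q * (q : ℝ) ^ (65 : ℕ) := by ring
  have hq65_1 : (1 : ℝ) ≤ (q : ℝ) ^ (65 : ℕ) := one_le_pow₀ hq1
  have h2q65 : 2 * (q : ℝ) ^ (65 : ℕ) ≤ T := by nlinarith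
  have hq4_1 : ((q ^ 4 : ℕ) : ℝ) + 1 ≤ T := by
    have h4 : ((q ^ 4 : ℕ) : ℝ) = (q : ℝ) ^ 4 := by push_cast; ring
    have : (q : ℝ) ^ 4 ≤ (q : ℝ) ^ (65 : ℕ) := pow_le_pow_right₀ hq1 (by norm_num)
    rw [h4]; nlinarith
  have hT3 : 3 ≤ T := by linarith
  -- `Q(2T+2) ≤ qT`: `Q = √q/2π ≤ √q/6 ≤ q/6` and `2T + 2 ≤ 4T`
  have hQ : condQ q * (2 * T + 2) ≤ q * T := by
    have hsqrt : Real.sqrt q ≤ q := by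
      rw [Real.sqrt_le_left hq0.le]; nlinarith
    have hQle : condQ q ≤ q / 6 := by
      unfold condQ
      rw [div_le_div_iff₀ (by positivity) (by norm_num)]
      nlinarith [Real.pi_gt_three]
    have hcQ : 0 ≤ condQ q := (condQ_pos (by omega)).le
    nlinarith
  -- `q (log T)^7 ≤ 8^7 T`
  have hlog7 : (q : ℝ) * Real.log T ^ 7 ≤ 8 ^ 7 * T := by
    have h1 := log_pow_le_rpow hT1 7
    have hq66 : (q : ℝ) ≤ T ^ ((1 : ℝ) / 66) := by
      have : ((q : ℝ) ^ (66 : ℕ)) ^ ((1 : ℝ) / 66) ≤ T ^ ((1 : ℝ) / 66) :=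
        Real.rpow_le_rpow (by positivity) hT (by norm_num)
      rwa [← Real.rpow_natCast, ← Real.rpow_mul hq0.le, show ((66 : ℕ) : ℝ) * (1 / 66) = 1 by norm_num,
        Real.rpow_one] at this
    calc (q : ℝ) * Real.log T ^ 7 ≤ T ^ ((1 : ℝ) / 66) * (8 ^ 7 * T ^ (((7 : ℕ) : ℝ) / 8)) :=
          mul_le_mul hq66 h1 (by positivity) (by positivity)
      _ = 8 ^ 7 * (T ^ ((1 : ℝ) / 66) * T ^ (((7 : ℕ) : ℝ) / 8)) := by ring
      _ = 8 ^ 7 * T ^ ((1 : ℝ) / 66 + ((7 : ℕ) : ℝ) / 8) := by rw [← Real.rpow_add hT0]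
      _ ≤ 8 ^ 7 * T ^ (1 : ℝ) :=
          mul_le_mul_of_nonneg_left (Real.rpow_le_rpow_of_exponent_le hT1 (by norm_num)) (by norm_num)
      _ = 8 ^ 7 * T := by rw [Real.rpow_one]
  -- `q² T^{-1/2} (log T)² ≤ 64`
  have hlog2 : (q : ℝ) ^ 2 * T ^ (-(1 / 2 : ℝ)) * Real.log T ^ 2 ≤ 64 := by
    have h1 := log_pow_le_rpow hT1 2
    have hq33 : (q : ℝ) ^ 2 ≤ T ^ ((2 : ℝ) / 66) := by
      have : ((q : ℝ) ^ (66 : ℕ)) ^ ((2 : ℝ) / 66) ≤ T ^ ((2 : ℝ) / 66) :=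
        Real.rpow_le_rpow (by positivity) hT (by norm_num)
      rwa [← Real.rpow_natCast, ← Real.rpow_mul hq0.le, show ((66 : ℕ) : ℝ) * (2 / 66) = (2 : ℕ) by norm_num,
        Real.rpow_natCast] at this
    calc (q : ℝ) ^ 2 * T ^ (-(1 / 2 : ℝ)) * Real.log T ^ 2
        ≤ T ^ ((2 : ℝ) / 66) * T ^ (-(1 / 2 : ℝ)) * (8 ^ 2 * T ^ (((2 : ℕ) : ℝ) / 8)) := by
          gcongr
      _ = 64 * T ^ ((2 : ℝ) / 66 + -(1 / 2 : ℝ) + ((2 : ℕ) : ℝ) / 8) := by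
          rw [Real.rpow_add hT0, Real.rpow_add hT0]; ring
      _ ≤ 64 * T ^ (0 : ℝ) :=
          mul_le_mul_of_nonneg_left (Real.rpow_le_rpow_of_exponent_le hT1 (by norm_num)) (by norm_num)
      _ = 64 := by rw [Real.rpow_zero, mul_one]
  have hfloor : Real.log ((⌊2 * T⌋₊ : ℕ) : ℝ) ≤ Real.log T + 1 := by
    have h1 : ((⌊2 * T⌋₊ : ℕ) : ℝ) ≤ 2 * T := Nat.floor_le (by linarith)
    have h2 : (1 : ℝ) ≤ ((⌊2 * T⌋₊ : ℕ) : ℝ) := by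
      have : 1 ≤ ⌊2 * T⌋₊ := Nat.one_le_floor_iff _ |>.mpr (by linarith)
      exact_mod_cast this
    calc Real.log ((⌊2 * T⌋₊ : ℕ) : ℝ) ≤ Real.log (2 * T) := Real.log_le_log (by linarith) h1
      _ = Real.log 2 + Real.log T := Real.log_mul (by norm_num) hT0.ne'
      _ ≤ Real.log T + 1 := by linarith [Real.log_two_lt_d9]
  exact ⟨hℓ1, hℓLT, hLT1, hℓ_le, hq4_1, h2q65, hT3, hQ, hlog7, hlog2, hfloor, hqT⟩

/-- `Σ_{n ≤ N} ‖λ(n) n^{−1/2} b(n)‖² ≤ Σ_{n ≤ N} g(n)` termwise tool: `‖λ(n)n^{−1/2}‖² = |λ(n)|²/n`.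
[cite: ConreyIwaniec2002, §8 (8.6)] -/
theorem norm_sq_coeff_mul_cpow (lam : ℕ → ℂ) {n : ℕ} (hn : n ≠ 0) (b : ℂ) :
    ‖lam n * (n : ℂ) ^ (-(1 / 2 : ℂ)) * b‖ ^ 2 = ‖lam n‖ ^ 2 / n * ‖b‖ ^ 2 := by
  have hn0 : (0 : ℝ) < n := by exact_mod_cast Nat.pos_of_ne_zero hn
  have hc : ‖(n : ℂ) ^ (-(1 / 2 : ℂ))‖ ^ 2 = (n : ℝ)⁻¹ := by
    rw [Complex.norm_natCast_cpow_of_pos (Nat.pos_of_ne_zero hn)]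
    simp only [neg_re, one_div]
    rw [show ((2 : ℂ)⁻¹).re = (1 / 2 : ℝ) by simp, ← Real.rpow_natCast ((n : ℝ) ^ (-(1 / 2 : ℝ))) 2,
      ← Real.rpow_mul hn0.le]
    norm_num
    exact Real.rpow_neg_one (n : ℝ)
  rw [norm_mul, norm_mul, mul_pow, mul_pow, hc, div_eq_mul_inv]

/-- Points of a dyadic set: `|t| ≤ 2T`, `2 ≤ |t|`, `T ≤ t`, `‖½ + it‖ ≤ 2T + 2` and, for a close
companion, `‖½ + it′‖ ≤ 2T + 2`. [cite: ConreyIwaniec2002, §8 (8.1)–(8.4)] -/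
theorem point_facts {S : Finset ℝ} {T : ℝ} (hS : IsDyadicPointSet S T) (hT : 3 ≤ T) {t : ℝ}
    (ht : t ∈ S) {t' : ℝ} (hdist : |t' - t| ≤ 1) :
    |t| ≤ 2 * T ∧ 2 ≤ |t| ∧ (T ≤ t ∧ t ≤ 2 * T) ∧ ‖(1 / 2 : ℂ) + t * I‖ ≤ 2 * T + 2 ∧
      ‖(1 / 2 : ℂ) + t' * I‖ ≤ 2 * T + 2 := by
  obtain ⟨h1, h2⟩ := hS.1 t ht
  have ht0 : 0 < t := by linarith
  have habs : |t| = t := abs_of_pos ht0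
  have hn : ∀ x : ℝ, ‖(1 / 2 : ℂ) + x * I‖ ≤ 1 / 2 + |x| := fun x => by
    calc ‖(1 / 2 : ℂ) + x * I‖ ≤ ‖(1 / 2 : ℂ)‖ + ‖(x : ℂ) * I‖ := norm_add_le _ _
      _ = 1 / 2 + |x| := by
          rw [norm_mul, Complex.norm_I, mul_one, Complex.norm_real, Real.norm_eq_abs]
          norm_num
  have ht'abs : |t'| ≤ 2 * T + 1 := by
    have := abs_sub_abs_le_abs_sub t' t
    linarith
  refine ⟨by rw [habs]; exact h2, by rw [habs]; linarith, ⟨h1.le, h2⟩, (hn t).trans (by rw [habs]; linarith),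
    (hn t').trans (by linarith)⟩

/-! ## §1. The range `n ≤ q⁴` of `B(s)` -/

/-- **(8.6), first range**: `Σ_s |Σ_{n≤q⁴} λ(n)n^{−1/2} Θ₁Ω_s(log n) n^{−it}|² ≤ C·T(log q)^7`
(Lemma 5.3 with `c ≪ (log q)³`, `Σ_{n≤q⁴}|λ(n)|²/n ≤ (1 + 4 log q)⁴`).
[cite: ConreyIwaniec2002, §8 (8.5)–(8.6)] -/
theorem range1_B_le :
    ∃ C : ℝ, 0 < C ∧
    ∀ (q : ℕ) [NeZero q], 4 < q → ∀ (K : Type) [Field K] [NumberField K],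
      ∀ (χ : DirichletCharacter ℂ q), χ.IsPrimitive → χ.IsQuadratic → χ.Odd →
        Module.finrank ℚ K = 2 → NumberField.discr K = -(q : ℤ) →
          ∀ (ψ : ClassGroup (𝓞 K) →* ℂˣ) (T : ℝ) (S : Finset ℝ) (t' : ℝ → ℝ),
            (q : ℝ) ^ (66 : ℕ) ≤ T → Real.exp (Real.log q ^ (2 : ℕ)) ≤ T → IsDyadicPointSet S T →
              (∀ t ∈ S, t' t ≠ t ∧ |t' t - t| ≤ 1) →
              ∃ Θ₁ : ℝ → ℝ, (∀ u ∈ Set.Icc 0 (Real.log ((q ^ 4 : ℕ) : ℝ)), Θ₁ u = 1) ∧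
                ∑ t ∈ S, ‖∑ n ∈ Finset.Icc 1 (q ^ 4),
                    (twistCount K (classGroupCharIdealHom ψ) n * (n : ℂ) ^ (-(1 / 2 : ℂ))) *
                      ((Θ₁ (Real.log n) : ℂ) * afeOmega q t (t' t) (Real.log n)) *
                      (n : ℂ) ^ (-((t : ℂ) * I))‖ ^ 2 ≤
                  C * (T * Real.log q ^ 7) := by
  obtain ⟨KΩ, hKΩ, hwin⟩ := omega_window_admissible
  refine ⟨8 * Real.pi * KΩ * 343 * 3 * 625, by positivity, ?_⟩
  intro q _ hq K _ _ χ hprim hquad hodd h2 hdisc ψ T S t' hT hexpT hS ht'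
  obtain ⟨hℓ1, -, hLT1, -, hq41, -, hT3, -⟩ := prop81_numerics hq hT hexpT
  have hq0 : 0 < q := by omega
  have hT0 : 0 < T := by linarith
  set β : ℝ := Real.log ((q ^ 4 : ℕ) : ℝ) with hβ
  have hβ4 : β = 4 * Real.log q := by
    rw [hβ]; push_cast; rw [Real.log_pow]; push_cast; ring
  have hβ0 : 0 ≤ β := by rw [hβ4]; linarith
  obtain ⟨Θ, hΘ1, hΘ01, hadm⟩ := hwin β hβ0
  refine ⟨Θ, hΘ1, ?_⟩
  set lam : ℕ → ℂ := fun n => twistCount K (classGroupCharIdealHom ψ) n with hlam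
  have hlamd := norm_twistCount_le_card_divisors hprim hquad hodd K h2 hdisc ψ
  -- Lemma 5.3 with point-dependent weights
  have hmv := WeightedMeanValue.weighted_discreteMeanValue (q ^ 4)
    (fun n => lam n * (n : ℂ) ^ (-(1 / 2 : ℂ))) (T := 2 * T) (δ := 1) (c := KΩ * (β + 3) ^ 3) S
    (fun t u => (Θ u : ℂ) * afeOmega q t (t' t) u) (by linarith) one_pos le_rfl (by positivity)
    (fun t ht => (point_facts hS hT3 ht (ht' t ht).2).1)
    (fun t ht u hu htu => hS.2 t ht u hu htu)
    (fun t ht => hadm q hq0 t (t' t) (point_facts hS hT3 ht (ht' t ht).2).2.1 (ht' t ht).1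
      (ht' t ht).2)
  refine hmv.trans ?_
  -- the coefficient sum
  have hcoef : ∑ n ∈ Finset.Icc 1 (q ^ 4), ‖lam n * (n : ℂ) ^ (-(1 / 2 : ℂ))‖ ^ 2 ≤ (1 + β) ^ 4 := by
    have h := ZetaM4D.sum_card_divisors_sq_div_le (q ^ 4)
    refine le_trans (Finset.sum_le_sum fun n hn => ?_) h
    have hn : n ≠ 0 := by rw [Finset.mem_Icc] at hn; omega
    have := norm_sq_coeff_mul_cpow lam hn 1
    rw [mul_one, norm_one, one_pow, mul_one] at this
    rw [this]
    gcongr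
    exact hlamd n
  have hq4T : ((q ^ 4 : ℕ) : ℝ) ≤ T := by linarith
  have hb3 : (β + 3) ^ 3 ≤ 343 * Real.log q ^ 3 := by
    rw [hβ4, show (343 : ℝ) * Real.log q ^ 3 = (7 * Real.log q) ^ 3 by ring]
    exact pow_le_pow_left₀ (by linarith) (by linarith) 3
  have hb4 : (1 + β) ^ 4 ≤ 625 * Real.log q ^ 4 := by
    rw [hβ4, show (625 : ℝ) * Real.log q ^ 4 = (5 * Real.log q) ^ 4 by ring]
    exact pow_le_pow_left₀ (by linarith) (by linarith) 4
  have hl0 : 0 ≤ Real.log q := by linarith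
  have hcoef' := hcoef.trans hb4
  calc 8 * Real.pi * (KΩ * (β + 3) ^ 3) * 1⁻¹ * (2 * T + (q ^ 4 : ℕ)) *
        ∑ n ∈ Finset.Icc 1 (q ^ 4), ‖lam n * (n : ℂ) ^ (-(1 / 2 : ℂ))‖ ^ 2
      ≤ 8 * Real.pi * (KΩ * (343 * Real.log q ^ 3)) * 1⁻¹ * (2 * T + T) * (625 * Real.log q ^ 4) := by
        gcongr
    _ = 8 * Real.pi * KΩ * 343 * 3 * 625 * (T * Real.log q ^ 7) := by ring

/-! ## §2. The range `q⁴ < n < 2T` of `B(s)` -/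

/-- The coefficient sum of the middle range: `Σ_{q⁴<n≤2T} |λ(n)|²/n ≤ C·ℒ(T) log T`
(Corollary 6.3 in the large range, `X = q⁴ + 1`, `Y = 2T`; `√q X^{−9/20} ≤ 1/q ≤ L(1,χ)² ≤ ℒ(T)/log T`).
[cite: ConreyIwaniec2002, §8 (8.6), Corollary 6.3 (6.49)] -/
theorem middle_coeff_sum_le :
    ∃ C : ℝ, 0 < C ∧
    ∀ (q : ℕ) [NeZero q], 4 < q → ∀ (K : Type) [Field K] [NumberField K],
      ∀ (χ : DirichletCharacter ℂ q), χ.IsPrimitive → χ.IsQuadratic → χ.Odd →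
        Module.finrank ℚ K = 2 → NumberField.discr K = -(q : ℤ) →
          ∀ (ψ : ClassGroup (𝓞 K) →* ℂˣ) (T : ℝ),
            (q : ℝ) ^ (66 : ℕ) ≤ T → Real.exp (Real.log q ^ (2 : ℕ)) ≤ T →
              ∑ n ∈ Finset.Icc 1 ⌊2 * T⌋₊,
                ‖twistCount K (classGroupCharIdealHom ψ) n * (n : ℂ) ^ (-(1 / 2 : ℂ)) *
                  (((if q ^ 4 < n then 1 - Real.smoothTransition ((n : ℝ) / T - 1) else 0 : ℝ)) : ℂ)‖ ^ 2 ≤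
                C * (calL χ T * Real.log T) := by
  obtain ⟨C₆, hC₆, h63⟩ := corollary63_large
  refine ⟨5 * C₆, by positivity, ?_⟩
  intro q _ hq K _ _ χ hprim hquad hodd h2 hdisc ψ T hT hexpT
  obtain ⟨hℓ1, -, hLT1, -, hq41, -, hT3, -, -, -, -, hqT⟩ := prop81_numerics hq hT hexpT
  have hq0 : 0 < q := by omega
  have hq5 : (5 : ℝ) ≤ q := by exact_mod_cast hq
  have hqpos : (0 : ℝ) < q := by linarith
  have hT0 : 0 < T := by linarith
  set lam : ℕ → ℂ := fun n => twistCount K (classGroupCharIdealHom ψ) n with hlam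
  -- `|λ(n)| ≤ |τ(n,χ)|`
  have hν : ∀ I, ‖classGroupCharIdealHom ψ I‖ ≤ 1 := norm_classGroupCharIdealHom_le ψ
  have hcoefN : ∀ n, n ≠ 0 → ‖lam n‖ ≤ ‖divisorSumChar χ n‖ := fun n hn =>
    (norm_twistCount_le hν n).trans
      (le_of_eq (idealNormCount_eq_norm_divisorSumChar_of_quadratic hprim hquad hodd K h2 hdisc hn))
  -- termwise comparison with `𝟙_{n > q⁴} |τ(n,χ)|²/n`
  have hpt : ∀ n ∈ Finset.Icc 1 ⌊2 * T⌋₊,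
      ‖lam n * (n : ℂ) ^ (-(1 / 2 : ℂ)) *
        (((if q ^ 4 < n then 1 - Real.smoothTransition ((n : ℝ) / T - 1) else 0 : ℝ)) : ℂ)‖ ^ 2 ≤
      if q ^ 4 < n then ‖divisorSumChar χ n‖ ^ 2 / n else 0 := by
    intro n hn
    have hn0 : n ≠ 0 := by rw [Finset.mem_Icc] at hn; omega
    rw [norm_sq_coeff_mul_cpow lam hn0]
    split_ifs with h
    · have hη0 := Real.smoothTransition.nonneg ((n : ℝ) / T - 1)
      have hη1 := Real.smoothTransition.le_one ((n : ℝ) / T - 1)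
      have hb : ‖(((1 - Real.smoothTransition ((n : ℝ) / T - 1) : ℝ)) : ℂ)‖ ^ 2 ≤ 1 := by
        rw [Complex.norm_real, Real.norm_eq_abs, abs_of_nonneg (by linarith)]
        nlinarith
      calc ‖lam n‖ ^ 2 / n * ‖(((1 - Real.smoothTransition ((n : ℝ) / T - 1) : ℝ)) : ℂ)‖ ^ 2
          ≤ ‖divisorSumChar χ n‖ ^ 2 / n * 1 := by
            gcongr
            exact hcoefN n hn0
        _ = _ := mul_one _
    · simp
  refine (Finset.sum_le_sum hpt).trans ?_
  rw [← Finset.sum_filter]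
  have hfilter : (Finset.Icc 1 ⌊2 * T⌋₊).filter (fun n => q ^ 4 < n) = Finset.Icc (q ^ 4 + 1) ⌊2 * T⌋₊ := by
    ext n
    simp only [Finset.mem_filter, Finset.mem_Icc]
    omega
  rw [hfilter]
  -- Corollary 6.3 (large range) with `X = q⁴ + 1`, `Y = 2T`
  have hX2 : (q : ℝ) ^ 2 ≤ ((q ^ 4 + 1 : ℕ) : ℝ) := by
    push_cast; nlinarith [pow_le_pow_right₀ (by linarith : (1 : ℝ) ≤ q) (by norm_num : 2 ≤ 4)]
  have hXY : 2 * ((q ^ 4 + 1 : ℕ) : ℝ) ≤ 2 * T := by push_cast at hq41 ⊢; linarith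
  have h := h63 q hq χ hprim hquad hodd ((q ^ 4 + 1 : ℕ) : ℝ) (2 * T) hX2 hXY
  rw [Nat.ceil_natCast] at h
  refine h.trans ?_
  -- numerics: `ℒ(2T) log(2T/X) ≤ 4 ℒ(T) log T`, `√q X^{-9/20} ≤ ℒ(T)`
  have hL := norm_LFunction_one_ge q hq χ hprim hquad hodd K h2 hdisc
  obtain ⟨hL1q, hL1T, -, -⟩ := calL_numerics hq χ hqT hL
  have hcalL0 : 0 ≤ calL χ T := calL_nonneg χ (by linarith)
  have hc2 : calL χ (2 * T) ≤ 2 * calL χ T := calL_two_mul_le χ (by linarith)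
  have hX1 : (1 : ℝ) ≤ ((q ^ 4 + 1 : ℕ) : ℝ) := by exact_mod_cast Nat.le_add_left 1 _
  have hlogYX : Real.log (2 * T / ((q ^ 4 + 1 : ℕ) : ℝ)) ≤ 2 * Real.log T := by
    have h1 : 2 * T / ((q ^ 4 + 1 : ℕ) : ℝ) ≤ 2 * T := div_le_self (by linarith) hX1
    calc Real.log (2 * T / ((q ^ 4 + 1 : ℕ) : ℝ)) ≤ Real.log (2 * T) :=
          Real.log_le_log (by positivity) h1
      _ = Real.log 2 + Real.log T := Real.log_mul (by norm_num) hT0.ne'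
      _ ≤ 2 * Real.log T := by linarith [Real.log_two_lt_d9]
  have hlogYX0 : 0 ≤ Real.log (2 * T / ((q ^ 4 + 1 : ℕ) : ℝ)) := by
    apply Real.log_nonneg
    rw [le_div_iff₀ (by positivity)]; linarith
  -- `√q · X^{-9/20} ≤ 1/q ≤ L(1,χ)² ≤ ℒ(T)` (using `log T ≥ 1`)
  have hrem : Real.sqrt q * ((q ^ 4 + 1 : ℕ) : ℝ) ^ (-(9 / 20 : ℝ)) ≤ calL χ T := by
    have h1 : ((q ^ 4 + 1 : ℕ) : ℝ) ^ (-(9 / 20 : ℝ)) ≤ ((q : ℝ) ^ 4) ^ (-(9 / 20 : ℝ)) := by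
      apply Real.rpow_le_rpow_of_nonpos (by positivity) (by push_cast; linarith) (by norm_num)
    have h2 : Real.sqrt q * ((q : ℝ) ^ 4) ^ (-(9 / 20 : ℝ)) = (q : ℝ) ^ (-(13 / 10 : ℝ)) := by
      rw [Real.sqrt_eq_rpow, ← Real.rpow_natCast, ← Real.rpow_mul hqpos.le, ← Real.rpow_add hqpos]
      norm_num
    have h3 : (q : ℝ) ^ (-(13 / 10 : ℝ)) ≤ (q : ℝ) ^ (-(1 : ℝ)) :=
      Real.rpow_le_rpow_of_exponent_le (by linarith) (by norm_num)
    have h4 : (q : ℝ) ^ (-(1 : ℝ)) = 1 / q := by rw [Real.rpow_neg_one, one_div]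
    have h5 : 1 / (q : ℝ) ≤ ‖χ.LFunction 1‖ ^ 2 := by
      rw [div_le_iff₀ hqpos]; exact hL1q
    have h6 : ‖χ.LFunction 1‖ ^ 2 ≤ calL χ T := by
      have : ‖χ.LFunction 1‖ ^ 2 * 1 ≤ ‖χ.LFunction 1‖ ^ 2 * Real.log T :=
        mul_le_mul_of_nonneg_left hLT1 (sq_nonneg _)
      linarith
    calc Real.sqrt q * ((q ^ 4 + 1 : ℕ) : ℝ) ^ (-(9 / 20 : ℝ))
        ≤ Real.sqrt q * ((q : ℝ) ^ 4) ^ (-(9 / 20 : ℝ)) := by gcongr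
      _ ≤ calL χ T := by rw [h2]; linarith
  calc C₆ * (calL χ (2 * T) * Real.log (2 * T / ((q ^ 4 + 1 : ℕ) : ℝ)) +
        Real.sqrt q * ((q ^ 4 + 1 : ℕ) : ℝ) ^ (-(9 / 20 : ℝ)))
      ≤ C₆ * (2 * calL χ T * (2 * Real.log T) + calL χ T) := by
        gcongr
    _ ≤ C₆ * (2 * calL χ T * (2 * Real.log T) + calL χ T * Real.log T) := by
        gcongr
        nlinarith
    _ = 5 * C₆ * (calL χ T * Real.log T) := by ring

/-- **(8.6), middle range**: `Σ_s |Σ_{n≤⌊2T⌋} λ(n)n^{−1/2}p₂(n) Θ₂Ω_s(log n) n^{−it}|² ≤ C·Tℒ(T)(log T)^4`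
(Lemma 5.3 with `c ≪ (log T)³` and `middle_coeff_sum_le`). [cite: ConreyIwaniec2002, §8 (8.5)–(8.6)] -/
theorem range2_B_le :
    ∃ C : ℝ, 0 < C ∧
    ∀ (q : ℕ) [NeZero q], 4 < q → ∀ (K : Type) [Field K] [NumberField K],
      ∀ (χ : DirichletCharacter ℂ q), χ.IsPrimitive → χ.IsQuadratic → χ.Odd →
        Module.finrank ℚ K = 2 → NumberField.discr K = -(q : ℤ) →
          ∀ (ψ : ClassGroup (𝓞 K) →* ℂˣ) (T : ℝ) (S : Finset ℝ) (t' : ℝ → ℝ),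
            (q : ℝ) ^ (66 : ℕ) ≤ T → Real.exp (Real.log q ^ (2 : ℕ)) ≤ T → IsDyadicPointSet S T →
              (∀ t ∈ S, t' t ≠ t ∧ |t' t - t| ≤ 1) →
              ∃ Θ₂ : ℝ → ℝ, (∀ u ∈ Set.Icc 0 (Real.log ((⌊2 * T⌋₊ : ℕ) : ℝ)), Θ₂ u = 1) ∧
                ∑ t ∈ S, ‖∑ n ∈ Finset.Icc 1 ⌊2 * T⌋₊,
                    (twistCount K (classGroupCharIdealHom ψ) n * (n : ℂ) ^ (-(1 / 2 : ℂ)) *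
                      (((if q ^ 4 < n then 1 - Real.smoothTransition ((n : ℝ) / T - 1) else 0 : ℝ)) : ℂ)) *
                      ((Θ₂ (Real.log n) : ℂ) * afeOmega q t (t' t) (Real.log n)) *
                      (n : ℂ) ^ (-((t : ℂ) * I))‖ ^ 2 ≤
                  C * (T * calL χ T * Real.log T ^ 4) := by
  obtain ⟨KΩ, hKΩ, hwin⟩ := omega_window_admissible
  obtain ⟨Cm, hCm, hmid⟩ := middle_coeff_sum_le
  refine ⟨8 * Real.pi * KΩ * 125 * 4 * Cm, by positivity, ?_⟩
  intro q _ hq K _ _ χ hprim hquad hodd h2 hdisc ψ T S t' hT hexpT hS ht'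
  obtain ⟨hℓ1, -, hLT1, -, hq41, -, hT3, -, -, -, hfloor, -⟩ := prop81_numerics hq hT hexpT
  have hq0 : 0 < q := by omega
  have hT0 : 0 < T := by linarith
  set N : ℕ := ⌊2 * T⌋₊ with hN
  have hN1 : 1 ≤ N := Nat.one_le_floor_iff _ |>.mpr (by linarith)
  have hNle : (N : ℝ) ≤ 2 * T := Nat.floor_le (by linarith)
  set β : ℝ := Real.log (N : ℝ) with hβ
  have hβ0 : 0 ≤ β := Real.log_nonneg (by exact_mod_cast hN1)
  have hβle : β + 3 ≤ 5 * Real.log T := by linarith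
  obtain ⟨Θ, hΘ1, hΘ01, hadm⟩ := hwin β hβ0
  refine ⟨Θ, hΘ1, ?_⟩
  set a : ℕ → ℂ := fun n => twistCount K (classGroupCharIdealHom ψ) n * (n : ℂ) ^ (-(1 / 2 : ℂ)) *
    (((if q ^ 4 < n then 1 - Real.smoothTransition ((n : ℝ) / T - 1) else 0 : ℝ)) : ℂ) with ha
  have hmv := WeightedMeanValue.weighted_discreteMeanValue N a (T := 2 * T) (δ := 1)
    (c := KΩ * (β + 3) ^ 3) S (fun t u => (Θ u : ℂ) * afeOmega q t (t' t) u) (by linarith) one_pos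
    le_rfl (by positivity)
    (fun t ht => (point_facts hS hT3 ht (ht' t ht).2).1)
    (fun t ht u hu htu => hS.2 t ht u hu htu)
    (fun t ht => hadm q hq0 t (t' t) (point_facts hS hT3 ht (ht' t ht).2).2.1 (ht' t ht).1
      (ht' t ht).2)
  refine hmv.trans ?_
  have hcoef := hmid q hq K χ hprim hquad hodd h2 hdisc ψ T hT hexpT
  have hcalL0 : 0 ≤ calL χ T := calL_nonneg χ (by linarith)
  have hb3 : (β + 3) ^ 3 ≤ 125 * Real.log T ^ 3 := by
    rw [show (125 : ℝ) * Real.log T ^ 3 = (5 * Real.log T) ^ 3 by ring]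
    exact pow_le_pow_left₀ (by linarith) hβle 3
  calc 8 * Real.pi * (KΩ * (β + 3) ^ 3) * 1⁻¹ * (2 * T + N) * ∑ n ∈ Finset.Icc 1 N, ‖a n‖ ^ 2
      ≤ 8 * Real.pi * (KΩ * (125 * Real.log T ^ 3)) * 1⁻¹ * (2 * T + 2 * T) *
          (Cm * (calL χ T * Real.log T)) := by gcongr
    _ = 8 * Real.pi * KΩ * 125 * 4 * Cm * (T * calL χ T * Real.log T ^ 4) := by ring

/-! ## §3. The range `n > T` of `B(s)` -/

set_option maxHeartbeats 400000 in
/-- **(8.7), long range**: with Proposition 6.4 as the binder `h64` and the divisor second moment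
`hdiv` (S6b), there are absolute `C, c₀ > 0` such that for the tail cut-off `a = tailCutoff c₀ q T`
and the half-window `Θ₃` at `log T`,
`Σ_s |Σ_n a(n)λ(n)n^{−1/2} Θ₃Ω_s(1+n/qT)⁴/c₀ (log n) n^{−it}|² ≤ C(T(log q)^7 + Tℒ(T)(log T)^4)`
(Proposition 5.4 with `c ≪ (log T)² log q`, (6.52) on `[T/2, 3T]`, error `Σ(1+n/T)|a_n|² ≪ q(log qT)⁴`).
[cite: ConreyIwaniec2002, §8 (8.7), Proposition 5.4, Proposition 6.4] -/
theorem range3_B_le (h64 : conreyIwaniec2002_proposition64)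
    (hdiv : ∃ C : ℝ, 0 < C ∧ ∀ Y : ℝ, 2 ≤ Y →
      Summable (fun n : ℕ => ((1 + (n : ℝ) / Y) ^ 8)⁻¹ * (n.divisors.card : ℝ) ^ 2) ∧
      ∑' n : ℕ, ((1 + (n : ℝ) / Y) ^ 8)⁻¹ * (n.divisors.card : ℝ) ^ 2 ≤
        C * Y * (1 + Real.log Y) ^ 4) :
    ∃ C c₀ : ℝ, 0 < C ∧ 0 < c₀ ∧
    ∀ (q : ℕ) [NeZero q], 4 < q → Odd q → ∀ (K : Type) [Field K] [NumberField K],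
      ∀ (χ : DirichletCharacter ℂ q), χ.IsPrimitive → χ.IsQuadratic → χ.Odd →
        Module.finrank ℚ K = 2 → NumberField.discr K = -(q : ℤ) →
          ∀ (ψ : ClassGroup (𝓞 K) →* ℂˣ) (T : ℝ) (S : Finset ℝ) (t' : ℝ → ℝ),
            (q : ℝ) ^ (66 : ℕ) ≤ T → Real.exp (Real.log q ^ (2 : ℕ)) ≤ T → IsDyadicPointSet S T →
              (∀ t ∈ S, t' t ≠ t ∧ |t' t - t| ≤ 1) →
              ∃ Θ₃ : ℝ → ℝ, (∀ u, Real.log T ≤ u → Θ₃ u = 1) ∧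
                ∑ t ∈ S, ‖∑' n : ℕ,
                    ((tailCutoff c₀ q T n : ℂ) * twistCount K (classGroupCharIdealHom ψ) n *
                      (n : ℂ) ^ (-(1 / 2 : ℂ))) *
                    ((Θ₃ (Real.log n) : ℂ) * (afeOmega q t (t' t) (Real.log n) *
                      (((1 + Real.exp (Real.log n) / (q * T)) ^ 4 / c₀ : ℝ) : ℂ))) *
                    (n : ℂ) ^ (-((t : ℂ) * I))‖ ^ 2 ≤
                  C * (T * Real.log q ^ 7 + T * calL χ T * Real.log T ^ 4) := by
  obtain ⟨c₀, hc₀, -, hcut⟩ := exists_tailCutoff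
  obtain ⟨Kt, hKt, htail⟩ := omega_tail_admissible
  obtain ⟨C₄, hC₄, hwin3⟩ := integral_three_windows_le h64
  obtain ⟨Cb, hCb, hdivb⟩ := hdiv
  refine ⟨180 * 48 * Kt * C₄ / c₀ ^ 2 + 180 * 48 * 2 * 81 * 8 ^ 7 * Kt * Cb, c₀, by positivity, hc₀, ?_⟩
  intro q _ hq hodd K _ _ χ hprim hquad hχodd h2 hdisc ψ T S t' hT hexpT hS ht'
  obtain ⟨hℓ1, hℓLT, hLT1, hℓle, hq41, h2q65, hT3, hQT, hlog7, -, -, hqT⟩ := prop81_numerics hq hT hexpT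
  have hq0 : 0 < q := by omega
  have hq1 : (1 : ℝ) ≤ q := by exact_mod_cast hq0
  have hqpos : (0 : ℝ) < q := by linarith
  have hT0 : 0 < T := by linarith
  have hqT2 : (2 : ℝ) ≤ q * T := by nlinarith
  obtain ⟨Θ, hΘ1, hΘ0, hΘ01, hadm⟩ := htail q hq0 T c₀ hT3 hc₀ hQT
  refine ⟨Θ, hΘ1, ?_⟩
  obtain ⟨hL0, -, hL1le⟩ := logQT_facts hq0 hT3 hQT
  set L₁ : ℝ := Real.log (condQ q * (2 * T + 2)) with hL₁
  obtain ⟨hsumY, hbdY⟩ := hdivb (q * T) hqT2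
  -- the coefficients and their summability
  set a : ℕ → ℂ := fun n => (tailCutoff c₀ q T n : ℂ) * twistCount K (classGroupCharIdealHom ψ) n *
    (n : ℂ) ^ (-(1 / 2 : ℂ)) with ha
  have ha0 : a 0 = 0 := by simp [ha, twistCount_zero]
  have ha1 : Summable fun n => ‖a n‖ := tail_coeff_summable hq hprim hquad hχodd K h2 hdisc ψ hT0 hc₀.le
  obtain ⟨ha2, herr⟩ := tail_coeff_sq_summable_le hq hprim hquad hχodd K h2 hdisc ψ hT0 hc₀.le hsumY
  -- Proposition 5.4 (infinite series) with point-dependent weights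
  set c : ℝ := Kt / c₀ ^ 2 * (L₁ + 2) ^ 2 * (Real.log q + 2) with hc
  have hc0 : 0 ≤ c := by positivity
  have hmv := WeightedMeanValue.weighted_discreteMeanValue_integral_tsum a (T := T) (δ := 1) (c := c)
    (B := Kt / c₀ * (L₁ + 2)) S
    (fun t u => (Θ u : ℂ) * (afeOmega q t (t' t) u * (((1 + Real.exp u / (q * T)) ^ 4 / c₀ : ℝ) : ℂ)))
    (by linarith) one_pos le_rfl hc0 ha0 ha1 ha2
    (fun t ht => (point_facts hS hT3 ht (ht' t ht).2).2.2.1)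
    (fun t ht u hu htu => hS.2 t ht u hu htu)
    (fun t ht => by
      obtain ⟨-, h2t, -, hs, hs'⟩ := point_facts hS hT3 ht (ht' t ht).2
      obtain ⟨d1, d2, d3, d4, d5, d6, -⟩ := hadm t (t' t) h2t (ht' t ht).1 (ht' t ht).2 hs hs'
      exact ⟨d1, d2, d3, d4, d5, d6⟩)
    (fun t ht u => by
      obtain ⟨-, h2t, -, hs, hs'⟩ := point_facts hS hT3 ht (ht' t ht).2
      exact (hadm t (t' t) h2t (ht' t ht).1 (ht' t ht).2 hs hs').2.2.2.2.2.2 u)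
  refine hmv.trans ?_
  -- the main term: (6.52) on the three windows
  have hIS : ∀ T' : ℝ, T / 2 ≤ T' → T' ≤ 2 * T →
      IsCutoff (fun y : ℝ => ((tailCutoff c₀ q T y : ℝ) : ℂ)) T' (q * T') :=
    fun T' h1 h2 => hcut (q : ℝ) T T' hq1 hT0 h1 h2
  have hmain := hwin3 q hq hodd χ hprim hquad hχodd K h2 hdisc ψ T (fun y : ℝ => ((tailCutoff c₀ q T y : ℝ) : ℂ))
    h2q65 (hIS _ le_rfl (by linarith)) (hIS _ (by linarith) (by linarith)) (hIS _ (by linarith) le_rfl)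
  have hint : ∫ τ in (T / 2)..(3 * T), ‖∑' n : ℕ, a n * (n : ℂ) ^ (-((τ : ℂ) * I))‖ ^ 2 ≤
      C₄ * (T * calL χ T * Real.log q) := by
    refine le_of_eq_of_le (intervalIntegral.integral_congr fun τ _ => ?_) hmain
    simp only [ha]
    rw [tsum_tail_coeff_cpow_eq_LSeries]
  -- the error term
  have herr' : ∑' n : ℕ, (1 + n / T) * ‖a n‖ ^ 2 ≤ 2 * c₀ ^ 2 * Cb * q * (1 + Real.log (q * T)) ^ 4 := by
    refine herr.trans ?_
    calc 2 * c₀ ^ 2 / T * ∑' n : ℕ, ((1 + (n : ℝ) / (q * T)) ^ 8)⁻¹ * (n.divisors.card : ℝ) ^ 2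
        ≤ 2 * c₀ ^ 2 / T * (Cb * (q * T) * (1 + Real.log (q * T)) ^ 4) := by gcongr
      _ = 2 * c₀ ^ 2 * Cb * q * (1 + Real.log (q * T)) ^ 4 := by field_simp
  -- numerics
  have hcalL0 : 0 ≤ calL χ T := calL_nonneg χ (by linarith)
  have hlogqT : Real.log (q * T) = Real.log q + Real.log T := Real.log_mul hqpos.ne' hT0.ne'
  have hc_le : c ≤ 48 * Kt / c₀ ^ 2 * Real.log T ^ 2 * Real.log q := by
    have h1 : (L₁ + 2) ^ 2 ≤ 16 * Real.log T ^ 2 := by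
      rw [show (16 : ℝ) * Real.log T ^ 2 = (4 * Real.log T) ^ 2 by ring]
      exact pow_le_pow_left₀ (by linarith) (by linarith) 2
    have h2 : Real.log q + 2 ≤ 3 * Real.log q := by linarith
    calc c = Kt / c₀ ^ 2 * (L₁ + 2) ^ 2 * (Real.log q + 2) := hc
      _ ≤ Kt / c₀ ^ 2 * (16 * Real.log T ^ 2) * (3 * Real.log q) := by gcongr
      _ = 48 * Kt / c₀ ^ 2 * Real.log T ^ 2 * Real.log q := by ring
  have hmainN : c * (C₄ * (T * calL χ T * Real.log q)) ≤
      48 * Kt * C₄ / c₀ ^ 2 * (T * calL χ T * Real.log T ^ 4) := by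
    have hlq2 : Real.log q ^ 2 ≤ Real.log T ^ 2 := by nlinarith
    calc c * (C₄ * (T * calL χ T * Real.log q))
        ≤ (48 * Kt / c₀ ^ 2 * Real.log T ^ 2 * Real.log q) * (C₄ * (T * calL χ T * Real.log q)) := by
          gcongr
      _ = 48 * Kt * C₄ / c₀ ^ 2 * (T * calL χ T) * (Real.log T ^ 2 * Real.log q ^ 2) := by ring
      _ ≤ 48 * Kt * C₄ / c₀ ^ 2 * (T * calL χ T) * (Real.log T ^ 2 * Real.log T ^ 2) := by gcongr
      _ = 48 * Kt * C₄ / c₀ ^ 2 * (T * calL χ T * Real.log T ^ 4) := by ring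
  have herrN : c * (2 * c₀ ^ 2 * Cb * q * (1 + Real.log (q * T)) ^ 4) ≤
      48 * 2 * 81 * 8 ^ 7 * Kt * Cb * (T * Real.log q ^ 7) := by
    have h1 : (1 + Real.log (q * T)) ^ 4 ≤ 81 * Real.log T ^ 4 := by
      rw [hlogqT, show (81 : ℝ) * Real.log T ^ 4 = (3 * Real.log T) ^ 4 by ring]
      exact pow_le_pow_left₀ (by linarith) (by linarith) 4
    have h7 : Real.log T ^ 2 * Real.log q * Real.log T ^ 4 ≤ Real.log T ^ 7 := by
      calc Real.log T ^ 2 * Real.log q * Real.log T ^ 4 ≤ Real.log T ^ 2 * Real.log T * Real.log T ^ 4 := by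
            gcongr
        _ = Real.log T ^ 7 := by ring
    have hl7 : (1 : ℝ) ≤ Real.log q ^ 7 := one_le_pow₀ hℓ1
    calc c * (2 * c₀ ^ 2 * Cb * q * (1 + Real.log (q * T)) ^ 4)
        ≤ (48 * Kt / c₀ ^ 2 * Real.log T ^ 2 * Real.log q) *
            (2 * c₀ ^ 2 * Cb * q * (81 * Real.log T ^ 4)) := by gcongr
      _ = 48 * 2 * 81 * Kt * Cb * (c₀ ^ 2 / c₀ ^ 2) * (q * (Real.log T ^ 2 * Real.log q * Real.log T ^ 4)) := by
          ring
      _ ≤ 48 * 2 * 81 * Kt * Cb * 1 * (q * Real.log T ^ 7) := by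
          gcongr
          · exact le_of_eq (div_self (by positivity))
      _ ≤ 48 * 2 * 81 * Kt * Cb * 1 * (8 ^ 7 * T) := by gcongr
      _ = 48 * 2 * 81 * 8 ^ 7 * Kt * Cb * (T * 1) := by ring
      _ ≤ 48 * 2 * 81 * 8 ^ 7 * Kt * Cb * (T * Real.log q ^ 7) := by gcongr
  have hX1 : 0 ≤ T * Real.log q ^ 7 := by positivity
  have hX2 : 0 ≤ T * calL χ T * Real.log T ^ 4 := by positivity
  set Iint : ℝ := ∫ τ in (T / 2)..(3 * T), ‖∑' n : ℕ, a n * (n : ℂ) ^ (-((τ : ℂ) * I))‖ ^ 2 with hIint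
  set Esum : ℝ := ∑' n : ℕ, (1 + n / T) * ‖a n‖ ^ 2 with hEsum
  have hIE : Iint + Esum ≤ C₄ * (T * calL χ T * Real.log q) +
      2 * c₀ ^ 2 * Cb * q * (1 + Real.log (q * T)) ^ 4 := add_le_add hint herr'
  have step1 : 180 * c * 1⁻¹ * (Iint + Esum) ≤
      180 * (c * (C₄ * (T * calL χ T * Real.log q))) +
        180 * (c * (2 * c₀ ^ 2 * Cb * q * (1 + Real.log (q * T)) ^ 4)) := by
    calc 180 * c * 1⁻¹ * (Iint + Esum) = (180 * c) * (Iint + Esum) := by ring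
      _ ≤ (180 * c) * (C₄ * (T * calL χ T * Real.log q) +
          2 * c₀ ^ 2 * Cb * q * (1 + Real.log (q * T)) ^ 4) :=
          mul_le_mul_of_nonneg_left hIE (by positivity)
      _ = _ := by ring
  have step2 := add_le_add (mul_le_mul_of_nonneg_left hmainN (show (0 : ℝ) ≤ 180 by norm_num))
    (mul_le_mul_of_nonneg_left herrN (show (0 : ℝ) ≤ 180 by norm_num))
  have step3 : 180 * (48 * Kt * C₄ / c₀ ^ 2 * (T * calL χ T * Real.log T ^ 4)) +
      180 * (48 * 2 * 81 * 8 ^ 7 * Kt * Cb * (T * Real.log q ^ 7)) ≤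
      (180 * 48 * Kt * C₄ / c₀ ^ 2 + 180 * 48 * 2 * 81 * 8 ^ 7 * Kt * Cb) *
        (T * Real.log q ^ 7 + T * calL χ T * Real.log T ^ 4) := by
    have expand : (180 * 48 * Kt * C₄ / c₀ ^ 2 + 180 * 48 * 2 * 81 * 8 ^ 7 * Kt * Cb) *
        (T * Real.log q ^ 7 + T * calL χ T * Real.log T ^ 4) =
        (180 * (48 * Kt * C₄ / c₀ ^ 2 * (T * calL χ T * Real.log T ^ 4)) +
          180 * (48 * 2 * 81 * 8 ^ 7 * Kt * Cb * (T * Real.log q ^ 7))) +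
        (180 * 48 * Kt * C₄ / c₀ ^ 2 * (T * Real.log q ^ 7) +
          180 * 48 * 2 * 81 * 8 ^ 7 * Kt * Cb * (T * calL χ T * Real.log T ^ 4)) := by ring
    rw [expand]
    have hpos : 0 ≤ 180 * 48 * Kt * C₄ / c₀ ^ 2 * (T * Real.log q ^ 7) +
        180 * 48 * 2 * 81 * 8 ^ 7 * Kt * Cb * (T * calL χ T * Real.log T ^ 4) := by positivity
    exact le_add_of_nonneg_right hpos
  exact step1.trans (step2.trans step3)

/-! ## §4. The range `n ≤ q⁴` of `A(s) − N(s)` -/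

/-- **(8.9), first range**: `(log T)² Σ_s |Σ_{n≤q⁴} λ(n)n^{−1/2} Θ₁(V_s − 1)(log n) n^{−it}|² ≤ C·T(log q)^7`
(`V_s(n/Q) − 1 ≪ (n/QT)^{1/4}` on `n ≤ q⁴`: Lemma 5.3 with `c ≪ q²T^{−1/2} log q`, and
`q² T^{−1/2}(log T)² ≤ 64`). [cite: ConreyIwaniec2002, §8 (8.8)–(8.9), Lemma 7.2 (7.17)] -/
theorem range1_A_le :
    ∃ C : ℝ, 0 < C ∧
    ∀ (q : ℕ) [NeZero q], 4 < q → ∀ (K : Type) [Field K] [NumberField K],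
      ∀ (χ : DirichletCharacter ℂ q), χ.IsPrimitive → χ.IsQuadratic → χ.Odd →
        Module.finrank ℚ K = 2 → NumberField.discr K = -(q : ℤ) →
          ∀ (ψ : ClassGroup (𝓞 K) →* ℂˣ) (T : ℝ) (S : Finset ℝ),
            (q : ℝ) ^ (66 : ℕ) ≤ T → Real.exp (Real.log q ^ (2 : ℕ)) ≤ T → IsDyadicPointSet S T →
              ∃ Θ₁ : ℝ → ℝ, (∀ u ∈ Set.Icc 0 (Real.log ((q ^ 4 : ℕ) : ℝ)), Θ₁ u = 1) ∧
                Real.log T ^ 2 * ∑ t ∈ S, ‖∑ n ∈ Finset.Icc 1 (q ^ 4),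
                    (twistCount K (classGroupCharIdealHom ψ) n * (n : ℂ) ^ (-(1 / 2 : ℂ))) *
                      ((Θ₁ (Real.log n) : ℂ) * (afeVlog q (1 / 2 + t * I) (Real.log n) - 1)) *
                      (n : ℂ) ^ (-((t : ℂ) * I))‖ ^ 2 ≤
                  C * (T * Real.log q ^ 7) := by
  obtain ⟨KV, hKV, hwin⟩ := afeVlog_sub_one_window_admissible
  refine ⟨8 * Real.pi * KV * 30 * 3 * 625 * 64, by positivity, ?_⟩
  intro q _ hq K _ _ χ hprim hquad hodd h2 hdisc ψ T S hT hexpT hS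
  obtain ⟨hℓ1, -, hLT1, -, hq41, -, hT3, -, -, hlog2, -, -⟩ := prop81_numerics hq hT hexpT
  have hq0 : 0 < q := by omega
  have hq1 : (1 : ℝ) ≤ q := by exact_mod_cast hq0
  have hT0 : 0 < T := by linarith
  have hQ : 0 < condQ q := condQ_pos hq0
  set β : ℝ := Real.log ((q ^ 4 : ℕ) : ℝ) with hβ
  have hβ4 : β = 4 * Real.log q := by
    rw [hβ]; push_cast; rw [Real.log_pow]; push_cast; ring
  have hβ0 : 0 ≤ β := by rw [hβ4]; linarith
  obtain ⟨Θ, hΘ1, hΘ01, hadm⟩ := hwin β hβ0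
  refine ⟨Θ, hΘ1, ?_⟩
  set lam : ℕ → ℂ := fun n => twistCount K (classGroupCharIdealHom ψ) n with hlam
  have hlamd := norm_twistCount_le_card_divisors hprim hquad hodd K h2 hdisc ψ
  -- the uniform constant `c`
  set x : ℝ := Real.exp (β + 1) / condQ q with hx
  have hx0 : 0 ≤ x := by positivity
  set c : ℝ := KV * (x / T) ^ ((1 : ℝ) / 2) * (β + 2) with hc
  have hc0 : 0 ≤ c := by positivity
  have hω : ∀ t ∈ S,
      Differentiable ℝ (fun u => (Θ u : ℂ) * (afeVlog q (1 / 2 + t * I) u - 1)) ∧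
      Integrable (fun u => (Θ u : ℂ) * (afeVlog q (1 / 2 + t * I) u - 1)) ∧
      Integrable (deriv (fun u => (Θ u : ℂ) * (afeVlog q (1 / 2 + t * I) u - 1))) ∧
      MemLp (fun u => (Θ u : ℂ) * (afeVlog q (1 / 2 + t * I) u - 1)) 2 ∧
      MemLp (deriv (fun u => (Θ u : ℂ) * (afeVlog q (1 / 2 + t * I) u - 1))) 2 ∧
      (∫ u : ℝ, ‖(Θ u : ℂ) * (afeVlog q (1 / 2 + t * I) u - 1)‖ ^ 2) +
        (∫ u : ℝ, ‖deriv (fun u => (Θ u : ℂ) * (afeVlog q (1 / 2 + t * I) u - 1)) u‖ ^ 2) ≤ c := by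
    intro t ht
    obtain ⟨-, h2t, ⟨hTt, -⟩, -, -⟩ := point_facts hS hT3 ht (t' := t) (by simp)
    have him : 1 ≤ |(1 / 2 + (t : ℂ) * I).im| := by simp; linarith
    obtain ⟨d1, d2, d3, d4, d5, d6⟩ := hadm q hq0 (1 / 2 + t * I) (by simp; norm_num) (by simp; norm_num) him
    refine ⟨d1, d2, d3, d4, d5, d6.trans ?_⟩
    have hnorm : T ≤ ‖(1 / 2 : ℂ) + t * I‖ := by
      have h := Complex.abs_im_le_norm ((1 / 2 : ℂ) + t * I)
      simp at h
      have : T ≤ |t| := le_trans hTt (le_abs_self t)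
      linarith
    rw [hc]
    gcongr
  have hmv := WeightedMeanValue.weighted_discreteMeanValue (q ^ 4)
    (fun n => lam n * (n : ℂ) ^ (-(1 / 2 : ℂ))) (T := 2 * T) (δ := 1) (c := c) S
    (fun t u => (Θ u : ℂ) * (afeVlog q (1 / 2 + t * I) u - 1)) (by linarith) one_pos le_rfl hc0
    (fun t ht => (point_facts hS hT3 ht (t' := t) (by simp)).1)
    (fun t ht u hu htu => hS.2 t ht u hu htu) hω
  -- the coefficient sum
  have hcoef : ∑ n ∈ Finset.Icc 1 (q ^ 4), ‖lam n * (n : ℂ) ^ (-(1 / 2 : ℂ))‖ ^ 2 ≤ 625 * Real.log q ^ 4 := by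
    have h := ZetaM4D.sum_card_divisors_sq_div_le (q ^ 4)
    have hb4 : (1 + β) ^ 4 ≤ 625 * Real.log q ^ 4 := by
      rw [hβ4, show (625 : ℝ) * Real.log q ^ 4 = (5 * Real.log q) ^ 4 by ring]
      exact pow_le_pow_left₀ (by linarith) (by linarith) 4
    refine le_trans (le_trans (Finset.sum_le_sum fun n hn => ?_) h) hb4
    have hn : n ≠ 0 := by rw [Finset.mem_Icc] at hn; omega
    have := norm_sq_coeff_mul_cpow lam hn 1
    rw [mul_one, norm_one, one_pow, mul_one] at this
    rw [this]
    gcongr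
    exact hlamd n
  -- `c ≤ 30 KV q² T^{-1/2} log q`
  have hc_le : c ≤ KV * (5 * (q : ℝ) ^ 2 * T ^ (-(1 / 2 : ℝ))) * (6 * Real.log q) := by
    have hx24 : x ≤ 24 * (q : ℝ) ^ 4 := by
      rw [hx, hβ4, div_le_iff₀ hQ]
      have hQ8 : 1 / 8 ≤ condQ q := by
        unfold condQ
        rw [div_le_div_iff₀ (by norm_num) (by positivity)]
        have := Real.one_le_sqrt.mpr hq1
        nlinarith [Real.pi_le_four]
      have he : Real.exp (4 * Real.log q + 1) = Real.exp 1 * (q : ℝ) ^ 4 := by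
        rw [Real.exp_add, show (4 : ℝ) * Real.log q = Real.log ((q : ℝ) ^ 4) by
          rw [Real.log_pow]; norm_num, Real.exp_log (by positivity)]; ring
      rw [he]
      have h3 : Real.exp 1 ≤ 3 := le_of_lt (lt_trans Real.exp_one_lt_d9 (by norm_num))
      have : 0 ≤ (q : ℝ) ^ 4 := by positivity
      nlinarith
    have hsq : (x / T) ^ ((1 : ℝ) / 2) ≤ 5 * (q : ℝ) ^ 2 * T ^ (-(1 / 2 : ℝ)) := by
      have hy0 : 0 ≤ 5 * (q : ℝ) ^ 2 * T ^ (-(1 / 2 : ℝ)) := by positivity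
      have hy2 : (5 * (q : ℝ) ^ 2 * T ^ (-(1 / 2 : ℝ))) ^ 2 = 25 * (q : ℝ) ^ 4 / T := by
        rw [mul_pow, mul_pow, ← Real.rpow_natCast (T ^ (-(1 / 2 : ℝ))) 2, ← Real.rpow_mul hT0.le]
        norm_num
        rw [Real.rpow_neg_one]; ring
      rw [← Real.sqrt_eq_rpow]
      have hle : x / T ≤ (5 * (q : ℝ) ^ 2 * T ^ (-(1 / 2 : ℝ))) ^ 2 := by
        rw [hy2, div_le_div_iff₀ hT0 hT0]
        nlinarith
      calc Real.sqrt (x / T) ≤ Real.sqrt ((5 * (q : ℝ) ^ 2 * T ^ (-(1 / 2 : ℝ))) ^ 2) := Real.sqrt_le_sqrt hle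
        _ = 5 * (q : ℝ) ^ 2 * T ^ (-(1 / 2 : ℝ)) := Real.sqrt_sq hy0
    rw [hc]
    gcongr
    linarith
  have hcalc : Real.log T ^ 2 * (8 * Real.pi * c * 1⁻¹ * (2 * T + (q ^ 4 : ℕ)) *
      ∑ n ∈ Finset.Icc 1 (q ^ 4), ‖lam n * (n : ℂ) ^ (-(1 / 2 : ℂ))‖ ^ 2) ≤
      8 * Real.pi * KV * 30 * 3 * 625 * 64 * (T * Real.log q ^ 7) := by
    have hq4T : ((q ^ 4 : ℕ) : ℝ) ≤ T := by linarith
    have hl5 : Real.log q ^ 5 ≤ Real.log q ^ 7 := pow_le_pow_right₀ hℓ1 (by norm_num)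
    calc Real.log T ^ 2 * (8 * Real.pi * c * 1⁻¹ * (2 * T + (q ^ 4 : ℕ)) *
          ∑ n ∈ Finset.Icc 1 (q ^ 4), ‖lam n * (n : ℂ) ^ (-(1 / 2 : ℂ))‖ ^ 2)
        ≤ Real.log T ^ 2 * (8 * Real.pi * (KV * (5 * (q : ℝ) ^ 2 * T ^ (-(1 / 2 : ℝ))) * (6 * Real.log q)) *
            1⁻¹ * (2 * T + T) * (625 * Real.log q ^ 4)) := by gcongr
      _ = 8 * Real.pi * KV * 30 * 3 * 625 * ((q : ℝ) ^ 2 * T ^ (-(1 / 2 : ℝ)) * Real.log T ^ 2) *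
            (T * Real.log q ^ 5) := by ring
      _ ≤ 8 * Real.pi * KV * 30 * 3 * 625 * 64 * (T * Real.log q ^ 7) := by gcongr
  exact le_trans (mul_le_mul_of_nonneg_left hmv (sq_nonneg _)) hcalc

/-! ## §5. The range `q⁴ < n < 2T` of `A(s) − N(s)` -/

/-- **(8.9), middle range**: `(log T)² Σ_s |Σ_{n≤⌊2T⌋} λ(n)n^{−1/2}p₂(n) Θ₂V_s(log n) n^{−it}|² ≤ C·Tℒ(T)(log T)^4`
(Lemma 5.3 with `c ≪ log T`, `middle_coeff_sum_le`). [cite: ConreyIwaniec2002, §8 (8.8)–(8.9)] -/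
theorem range2_A_le :
    ∃ C : ℝ, 0 < C ∧
    ∀ (q : ℕ) [NeZero q], 4 < q → ∀ (K : Type) [Field K] [NumberField K],
      ∀ (χ : DirichletCharacter ℂ q), χ.IsPrimitive → χ.IsQuadratic → χ.Odd →
        Module.finrank ℚ K = 2 → NumberField.discr K = -(q : ℤ) →
          ∀ (ψ : ClassGroup (𝓞 K) →* ℂˣ) (T : ℝ) (S : Finset ℝ),
            (q : ℝ) ^ (66 : ℕ) ≤ T → Real.exp (Real.log q ^ (2 : ℕ)) ≤ T → IsDyadicPointSet S T →
              ∃ Θ₂ : ℝ → ℝ, (∀ u ∈ Set.Icc 0 (Real.log ((⌊2 * T⌋₊ : ℕ) : ℝ)), Θ₂ u = 1) ∧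
                Real.log T ^ 2 * ∑ t ∈ S, ‖∑ n ∈ Finset.Icc 1 ⌊2 * T⌋₊,
                    (twistCount K (classGroupCharIdealHom ψ) n * (n : ℂ) ^ (-(1 / 2 : ℂ)) *
                      (((if q ^ 4 < n then 1 - Real.smoothTransition ((n : ℝ) / T - 1) else 0 : ℝ)) : ℂ)) *
                      ((Θ₂ (Real.log n) : ℂ) * afeVlog q (1 / 2 + t * I) (Real.log n)) *
                      (n : ℂ) ^ (-((t : ℂ) * I))‖ ^ 2 ≤
                  C * (T * calL χ T * Real.log T ^ 4) := by
  obtain ⟨KV, hKV, hwin⟩ := afeVlog_window_admissible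
  obtain ⟨Cm, hCm, hmid⟩ := middle_coeff_sum_le
  refine ⟨8 * Real.pi * KV * 4 * 4 * Cm, by positivity, ?_⟩
  intro q _ hq K _ _ χ hprim hquad hodd h2 hdisc ψ T S hT hexpT hS
  obtain ⟨hℓ1, -, hLT1, -, hq41, -, hT3, -, -, -, hfloor, -⟩ := prop81_numerics hq hT hexpT
  have hq0 : 0 < q := by omega
  have hT0 : 0 < T := by linarith
  set N : ℕ := ⌊2 * T⌋₊ with hN
  have hN1 : 1 ≤ N := Nat.one_le_floor_iff _ |>.mpr (by linarith)
  have hNle : (N : ℝ) ≤ 2 * T := Nat.floor_le (by linarith)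
  set β : ℝ := Real.log (N : ℝ) with hβ
  have hβ0 : 0 ≤ β := Real.log_nonneg (by exact_mod_cast hN1)
  have hβle : β + 2 ≤ 4 * Real.log T := by linarith
  obtain ⟨Θ, hΘ1, hΘ01, hadm⟩ := hwin β hβ0
  refine ⟨Θ, hΘ1, ?_⟩
  set a : ℕ → ℂ := fun n => twistCount K (classGroupCharIdealHom ψ) n * (n : ℂ) ^ (-(1 / 2 : ℂ)) *
    (((if q ^ 4 < n then 1 - Real.smoothTransition ((n : ℝ) / T - 1) else 0 : ℝ)) : ℂ) with ha
  have hmv := WeightedMeanValue.weighted_discreteMeanValue N a (T := 2 * T) (δ := 1)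
    (c := KV * (β + 2)) S (fun t u => (Θ u : ℂ) * afeVlog q (1 / 2 + t * I) u) (by linarith) one_pos
    le_rfl (by positivity)
    (fun t ht => (point_facts hS hT3 ht (t' := t) (by simp)).1)
    (fun t ht u hu htu => hS.2 t ht u hu htu)
    (fun t ht => by
      obtain ⟨-, h2t, -⟩ := point_facts hS hT3 ht (t' := t) (by simp)
      have him : 1 ≤ |(1 / 2 + (t : ℂ) * I).im| := by simp; linarith
      exact hadm q hq0 (1 / 2 + t * I) (by simp; norm_num) (by simp; norm_num) him)
  have hcoef := hmid q hq K χ hprim hquad hodd h2 hdisc ψ T hT hexpT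
  have hcalL0 : 0 ≤ calL χ T := calL_nonneg χ (by linarith)
  calc Real.log T ^ 2 * ∑ t ∈ S, ‖∑ n ∈ Finset.Icc 1 N,
          a n * ((Θ (Real.log n) : ℂ) * afeVlog q (1 / 2 + t * I) (Real.log n)) * (n : ℂ) ^ (-((t : ℂ) * I))‖ ^ 2
      ≤ Real.log T ^ 2 * (8 * Real.pi * (KV * (β + 2)) * 1⁻¹ * (2 * T + N) * ∑ n ∈ Finset.Icc 1 N, ‖a n‖ ^ 2) :=
        mul_le_mul_of_nonneg_left hmv (sq_nonneg _)
    _ ≤ Real.log T ^ 2 * (8 * Real.pi * (KV * (4 * Real.log T)) * 1⁻¹ * (2 * T + 2 * T) *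
          (Cm * (calL χ T * Real.log T))) := by gcongr
    _ = 8 * Real.pi * KV * 4 * 4 * Cm * (T * calL χ T * Real.log T ^ 4) := by ring

/-! ## §6. The range `n > T` of `A(s) − N(s)` -/

/-- **(8.9), long range**: `(log T)² Σ_s |Σ_n a(n)λ(n)n^{−1/2} Θ₃V_s(1+n/qT)⁴/c₀ (log n) n^{−it}|²
≤ C(T(log q)^7 + Tℒ(T)(log T)^4)` (Proposition 5.4 with `c ≪ log q`, (6.52) on `[T/2, 3T]`,
S6b for the error term). [cite: ConreyIwaniec2002, §8 (8.7)–(8.9), Proposition 5.4, Proposition 6.4] -/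
theorem range3_A_le (h64 : conreyIwaniec2002_proposition64)
    (hdiv : ∃ C : ℝ, 0 < C ∧ ∀ Y : ℝ, 2 ≤ Y →
      Summable (fun n : ℕ => ((1 + (n : ℝ) / Y) ^ 8)⁻¹ * (n.divisors.card : ℝ) ^ 2) ∧
      ∑' n : ℕ, ((1 + (n : ℝ) / Y) ^ 8)⁻¹ * (n.divisors.card : ℝ) ^ 2 ≤
        C * Y * (1 + Real.log Y) ^ 4) :
    ∃ C c₀ : ℝ, 0 < C ∧ 0 < c₀ ∧
    ∀ (q : ℕ) [NeZero q], 4 < q → Odd q → ∀ (K : Type) [Field K] [NumberField K],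
      ∀ (χ : DirichletCharacter ℂ q), χ.IsPrimitive → χ.IsQuadratic → χ.Odd →
        Module.finrank ℚ K = 2 → NumberField.discr K = -(q : ℤ) →
          ∀ (ψ : ClassGroup (𝓞 K) →* ℂˣ) (T : ℝ) (S : Finset ℝ),
            (q : ℝ) ^ (66 : ℕ) ≤ T → Real.exp (Real.log q ^ (2 : ℕ)) ≤ T → IsDyadicPointSet S T →
              ∃ Θ₃ : ℝ → ℝ, (∀ u, Real.log T ≤ u → Θ₃ u = 1) ∧
                Real.log T ^ 2 * ∑ t ∈ S, ‖∑' n : ℕ,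
                    ((tailCutoff c₀ q T n : ℂ) * twistCount K (classGroupCharIdealHom ψ) n *
                      (n : ℂ) ^ (-(1 / 2 : ℂ))) *
                    ((Θ₃ (Real.log n) : ℂ) * (afeVlog q (1 / 2 + t * I) (Real.log n) *
                      (((1 + Real.exp (Real.log n) / (q * T)) ^ 4 / c₀ : ℝ) : ℂ))) *
                    (n : ℂ) ^ (-((t : ℂ) * I))‖ ^ 2 ≤
                  C * (T * Real.log q ^ 7 + T * calL χ T * Real.log T ^ 4) := by
  obtain ⟨c₀, hc₀, -, hcut⟩ := exists_tailCutoff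
  obtain ⟨Kt, hKt, htail⟩ := afeVlog_tail_admissible
  obtain ⟨C₄, hC₄, hwin3⟩ := integral_three_windows_le h64
  obtain ⟨Cb, hCb, hdivb⟩ := hdiv
  refine ⟨180 * 3 * Kt * C₄ / c₀ ^ 2 + 180 * 3 * 2 * 81 * 8 ^ 7 * Kt * Cb, c₀, by positivity, hc₀, ?_⟩
  intro q _ hq hodd K _ _ χ hprim hquad hχodd h2 hdisc ψ T S hT hexpT hS
  obtain ⟨hℓ1, hℓLT, hLT1, hℓle, hq41, h2q65, hT3, hQT, hlog7, -, -, hqT⟩ := prop81_numerics hq hT hexpT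
  have hq0 : 0 < q := by omega
  have hq1 : (1 : ℝ) ≤ q := by exact_mod_cast hq0
  have hqpos : (0 : ℝ) < q := by linarith
  have hT0 : 0 < T := by linarith
  have hqT2 : (2 : ℝ) ≤ q * T := by nlinarith
  obtain ⟨Θ, hΘ1, hΘ0, hΘ01, hadm⟩ := htail q hq0 T c₀ hT3 hc₀ hQT
  refine ⟨Θ, hΘ1, ?_⟩
  obtain ⟨hsumY, hbdY⟩ := hdivb (q * T) hqT2
  set a : ℕ → ℂ := fun n => (tailCutoff c₀ q T n : ℂ) * twistCount K (classGroupCharIdealHom ψ) n *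
    (n : ℂ) ^ (-(1 / 2 : ℂ)) with ha
  have ha0 : a 0 = 0 := by simp [ha, twistCount_zero]
  have ha1 : Summable fun n => ‖a n‖ := tail_coeff_summable hq hprim hquad hχodd K h2 hdisc ψ hT0 hc₀.le
  obtain ⟨ha2, herr⟩ := tail_coeff_sq_summable_le hq hprim hquad hχodd K h2 hdisc ψ hT0 hc₀.le hsumY
  set c : ℝ := Kt / c₀ ^ 2 * (Real.log q + 2) with hc
  have hc0 : 0 ≤ c := by positivity
  have hmv := WeightedMeanValue.weighted_discreteMeanValue_integral_tsum a (T := T) (δ := 1) (c := c)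
    (B := Kt / c₀) S
    (fun t u => (Θ u : ℂ) * (afeVlog q (1 / 2 + t * I) u * (((1 + Real.exp u / (q * T)) ^ 4 / c₀ : ℝ) : ℂ)))
    (by linarith) one_pos le_rfl hc0 ha0 ha1 ha2
    (fun t ht => (point_facts hS hT3 ht (t' := t) (by simp)).2.2.1)
    (fun t ht u hu htu => hS.2 t ht u hu htu)
    (fun t ht => by
      obtain ⟨-, h2t, -, hs, -⟩ := point_facts hS hT3 ht (t' := t) (by simp)
      have him : 1 ≤ |(1 / 2 + (t : ℂ) * I).im| := by simp; linarith
      obtain ⟨d1, d2, d3, d4, d5, d6, -⟩ := hadm (1 / 2 + t * I) (by simp; norm_num) (by simp; norm_num) him hs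
      exact ⟨d1, d2, d3, d4, d5, d6⟩)
    (fun t ht u => by
      obtain ⟨-, h2t, -, hs, -⟩ := point_facts hS hT3 ht (t' := t) (by simp)
      have him : 1 ≤ |(1 / 2 + (t : ℂ) * I).im| := by simp; linarith
      exact (hadm (1 / 2 + t * I) (by simp; norm_num) (by simp; norm_num) him hs).2.2.2.2.2.2 u)
  -- main term via (6.52) on three windows
  have hIS : ∀ T' : ℝ, T / 2 ≤ T' → T' ≤ 2 * T →
      IsCutoff (fun y : ℝ => ((tailCutoff c₀ q T y : ℝ) : ℂ)) T' (q * T') :=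
    fun T' h1 h2 => hcut (q : ℝ) T T' hq1 hT0 h1 h2
  have hmain := hwin3 q hq hodd χ hprim hquad hχodd K h2 hdisc ψ T (fun y : ℝ => ((tailCutoff c₀ q T y : ℝ) : ℂ))
    h2q65 (hIS _ le_rfl (by linarith)) (hIS _ (by linarith) (by linarith)) (hIS _ (by linarith) le_rfl)
  have hint : ∫ τ in (T / 2)..(3 * T), ‖∑' n : ℕ, a n * (n : ℂ) ^ (-((τ : ℂ) * I))‖ ^ 2 ≤
      C₄ * (T * calL χ T * Real.log q) := by
    refine le_of_eq_of_le (intervalIntegral.integral_congr fun τ _ => ?_) hmain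
    simp only [ha]
    rw [tsum_tail_coeff_cpow_eq_LSeries]
  have herr' : ∑' n : ℕ, (1 + n / T) * ‖a n‖ ^ 2 ≤ 2 * c₀ ^ 2 * Cb * q * (1 + Real.log (q * T)) ^ 4 := by
    refine herr.trans ?_
    calc 2 * c₀ ^ 2 / T * ∑' n : ℕ, ((1 + (n : ℝ) / (q * T)) ^ 8)⁻¹ * (n.divisors.card : ℝ) ^ 2
        ≤ 2 * c₀ ^ 2 / T * (Cb * (q * T) * (1 + Real.log (q * T)) ^ 4) := by gcongr
      _ = 2 * c₀ ^ 2 * Cb * q * (1 + Real.log (q * T)) ^ 4 := by field_simp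
  -- numerics
  have hcalL0 : 0 ≤ calL χ T := calL_nonneg χ (by linarith)
  have hlogqT : Real.log (q * T) = Real.log q + Real.log T := Real.log_mul hqpos.ne' hT0.ne'
  have hc_le : c ≤ 3 * Kt / c₀ ^ 2 * Real.log q := by
    rw [hc]
    have h2 : Real.log q + 2 ≤ 3 * Real.log q := by linarith
    calc Kt / c₀ ^ 2 * (Real.log q + 2) ≤ Kt / c₀ ^ 2 * (3 * Real.log q) := by gcongr
      _ = 3 * Kt / c₀ ^ 2 * Real.log q := by ring
  have hmainN : Real.log T ^ 2 * (c * (C₄ * (T * calL χ T * Real.log q))) ≤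
      3 * Kt * C₄ / c₀ ^ 2 * (T * calL χ T * Real.log T ^ 4) := by
    have hlq2 : Real.log T ^ 2 * Real.log q ^ 2 ≤ Real.log T ^ 4 := by
      calc Real.log T ^ 2 * Real.log q ^ 2 ≤ Real.log T ^ 2 * Real.log T := by gcongr
        _ ≤ Real.log T ^ 2 * Real.log T ^ 2 := by gcongr; nlinarith
        _ = Real.log T ^ 4 := by ring
    calc Real.log T ^ 2 * (c * (C₄ * (T * calL χ T * Real.log q)))
        ≤ Real.log T ^ 2 * ((3 * Kt / c₀ ^ 2 * Real.log q) * (C₄ * (T * calL χ T * Real.log q))) := by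
          gcongr
      _ = 3 * Kt * C₄ / c₀ ^ 2 * (T * calL χ T) * (Real.log T ^ 2 * Real.log q ^ 2) := by ring
      _ ≤ 3 * Kt * C₄ / c₀ ^ 2 * (T * calL χ T) * Real.log T ^ 4 := by gcongr
      _ = 3 * Kt * C₄ / c₀ ^ 2 * (T * calL χ T * Real.log T ^ 4) := by ring
  have herrN : Real.log T ^ 2 * (c * (2 * c₀ ^ 2 * Cb * q * (1 + Real.log (q * T)) ^ 4)) ≤
      3 * 2 * 81 * 8 ^ 7 * Kt * Cb * (T * Real.log q ^ 7) := by
    have h1 : (1 + Real.log (q * T)) ^ 4 ≤ 81 * Real.log T ^ 4 := by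
      rw [hlogqT, show (81 : ℝ) * Real.log T ^ 4 = (3 * Real.log T) ^ 4 by ring]
      exact pow_le_pow_left₀ (by linarith) (by linarith) 4
    have hl7 : (1 : ℝ) ≤ Real.log q ^ 7 := one_le_pow₀ hℓ1
    calc Real.log T ^ 2 * (c * (2 * c₀ ^ 2 * Cb * q * (1 + Real.log (q * T)) ^ 4))
        ≤ Real.log T ^ 2 * ((3 * Kt / c₀ ^ 2 * Real.log q) * (2 * c₀ ^ 2 * Cb * q * (81 * Real.log T ^ 4))) := by
          gcongr
      _ = 3 * 2 * 81 * Kt * Cb * (c₀ ^ 2 / c₀ ^ 2) * (q * (Real.log T ^ 2 * Real.log q * Real.log T ^ 4)) := by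
          ring
      _ ≤ 3 * 2 * 81 * Kt * Cb * 1 * (q * Real.log T ^ 7) := by
          gcongr
          · exact le_of_eq (div_self (by positivity))
          · calc Real.log T ^ 2 * Real.log q * Real.log T ^ 4 ≤ Real.log T ^ 2 * Real.log T * Real.log T ^ 4 := by
                  gcongr
              _ = Real.log T ^ 7 := by ring
      _ ≤ 3 * 2 * 81 * Kt * Cb * 1 * (8 ^ 7 * T) := by gcongr
      _ = 3 * 2 * 81 * 8 ^ 7 * Kt * Cb * (T * 1) := by ring
      _ ≤ 3 * 2 * 81 * 8 ^ 7 * Kt * Cb * (T * Real.log q ^ 7) := by gcongr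
  have hX1 : 0 ≤ T * Real.log q ^ 7 := by positivity
  have hX2 : 0 ≤ T * calL χ T * Real.log T ^ 4 := by positivity
  set Iint : ℝ := ∫ τ in (T / 2)..(3 * T), ‖∑' n : ℕ, a n * (n : ℂ) ^ (-((τ : ℂ) * I))‖ ^ 2 with hIint
  set Esum : ℝ := ∑' n : ℕ, (1 + n / T) * ‖a n‖ ^ 2 with hEsum
  have hIE : Iint + Esum ≤ C₄ * (T * calL χ T * Real.log q) +
      2 * c₀ ^ 2 * Cb * q * (1 + Real.log (q * T)) ^ 4 := add_le_add hint herr'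
  have hL2 : 0 ≤ Real.log T ^ 2 := by positivity
  have step0 := mul_le_mul_of_nonneg_left hmv hL2
  have step1 : Real.log T ^ 2 * (180 * c * 1⁻¹ * (Iint + Esum)) ≤
      180 * (Real.log T ^ 2 * (c * (C₄ * (T * calL χ T * Real.log q)))) +
        180 * (Real.log T ^ 2 * (c * (2 * c₀ ^ 2 * Cb * q * (1 + Real.log (q * T)) ^ 4))) := by
    calc Real.log T ^ 2 * (180 * c * 1⁻¹ * (Iint + Esum))
        = (Real.log T ^ 2 * (180 * c)) * (Iint + Esum) := by ring
      _ ≤ (Real.log T ^ 2 * (180 * c)) * (C₄ * (T * calL χ T * Real.log q) +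
          2 * c₀ ^ 2 * Cb * q * (1 + Real.log (q * T)) ^ 4) :=
          mul_le_mul_of_nonneg_left hIE (by positivity)
      _ = _ := by ring
  have step2 := add_le_add (mul_le_mul_of_nonneg_left hmainN (show (0 : ℝ) ≤ 180 by norm_num))
    (mul_le_mul_of_nonneg_left herrN (show (0 : ℝ) ≤ 180 by norm_num))
  have step3 : 180 * (3 * Kt * C₄ / c₀ ^ 2 * (T * calL χ T * Real.log T ^ 4)) +
      180 * (3 * 2 * 81 * 8 ^ 7 * Kt * Cb * (T * Real.log q ^ 7)) ≤
      (180 * 3 * Kt * C₄ / c₀ ^ 2 + 180 * 3 * 2 * 81 * 8 ^ 7 * Kt * Cb) *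
        (T * Real.log q ^ 7 + T * calL χ T * Real.log T ^ 4) := by
    have expand : (180 * 3 * Kt * C₄ / c₀ ^ 2 + 180 * 3 * 2 * 81 * 8 ^ 7 * Kt * Cb) *
        (T * Real.log q ^ 7 + T * calL χ T * Real.log T ^ 4) =
        (180 * (3 * Kt * C₄ / c₀ ^ 2 * (T * calL χ T * Real.log T ^ 4)) +
          180 * (3 * 2 * 81 * 8 ^ 7 * Kt * Cb * (T * Real.log q ^ 7))) +
        (180 * 3 * Kt * C₄ / c₀ ^ 2 * (T * Real.log q ^ 7) +
          180 * 3 * 2 * 81 * 8 ^ 7 * Kt * Cb * (T * calL χ T * Real.log T ^ 4)) := by ring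
    rw [expand]
    have hpos : 0 ≤ 180 * 3 * Kt * C₄ / c₀ ^ 2 * (T * Real.log q ^ 7) +
        180 * 3 * 2 * 81 * 8 ^ 7 * Kt * Cb * (T * calL χ T * Real.log T ^ 4) := by positivity
    exact le_add_of_nonneg_right hpos
  exact step0.trans (step1.trans (step2.trans step3))

/-! ## §7. Assembly: the two main mean squares of §8 (S6c of the `prop81-afe-plancherel` line) -/

/-- Bookkeeping: if `f ≤ 3(P₁ + P₂ + P₃)` pointwise on `S` and `w·ΣP_j ≤ B_j` (`w ≥ 0`), then
`w·Σf ≤ 3(B₁ + B₂ + B₃)`. [cite: ConreyIwaniec2002, §8 (8.5)] -/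
theorem weighted_sum_three_le {S : Finset ℝ} {f P₁ P₂ P₃ : ℝ → ℝ} {w B₁ B₂ B₃ : ℝ} (hw : 0 ≤ w)
    (hpt : ∀ t ∈ S, f t ≤ 3 * (P₁ t + P₂ t + P₃ t)) (h1 : w * ∑ t ∈ S, P₁ t ≤ B₁)
    (h2 : w * ∑ t ∈ S, P₂ t ≤ B₂) (h3 : w * ∑ t ∈ S, P₃ t ≤ B₃) :
    w * ∑ t ∈ S, f t ≤ 3 * (B₁ + B₂ + B₃) := by
  have hs : ∑ t ∈ S, f t ≤ 3 * (∑ t ∈ S, P₁ t + ∑ t ∈ S, P₂ t + ∑ t ∈ S, P₃ t) := by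
    refine (Finset.sum_le_sum hpt).trans (le_of_eq ?_)
    rw [← Finset.mul_sum, Finset.sum_add_distrib, Finset.sum_add_distrib]
  have := mul_le_mul_of_nonneg_left hs hw
  linarith [this]

/-- **CI Proposition 8.1, the two main mean squares (8.5)–(8.9)** — the registered stub S6c
`stub_main_meanSquares` of the `prop81-afe-plancherel` line: with Proposition 6.4 as the binder `h64`
and the divisor second moment `hdiv` (S6b), there is an absolute `C` with, for `q` odd `> 4`,
`K = ℚ(√−q)`, `ψ ∈ Ĉℓ(K)`, `1`-spaced `S ⊂ (T, 2T]`, `q^66 ≤ T`, `e^{(log q)²} ≤ T`, companions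
`0 < |t′ − t| ≤ 1`:
(i) `Σ_{t∈S} |(A(s) − A(s′))/(s − s′)|² ≤ C(T(log q)^7 + Tℒ(T)(log T)^4)`;
(ii) `(log T)² Σ_{t∈S} |A(s) − N(s)|² ≤ C(T(log q)^7 + Tℒ(T)(log T)^4)`.
[cite: ConreyIwaniec2002, §8 (8.5)–(8.10)] -/
theorem main_meanSquares (h64 : conreyIwaniec2002_proposition64)
    (hdiv : ∃ C : ℝ, 0 < C ∧ ∀ Y : ℝ, 2 ≤ Y →
      Summable (fun n : ℕ => ((1 + (n : ℝ) / Y) ^ 8)⁻¹ * (n.divisors.card : ℝ) ^ 2) ∧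
      ∑' n : ℕ, ((1 + (n : ℝ) / Y) ^ 8)⁻¹ * (n.divisors.card : ℝ) ^ 2 ≤
        C * Y * (1 + Real.log Y) ^ 4) :
    ∃ C : ℝ, 0 < C ∧
    ∀ (q : ℕ) [NeZero q], 4 < q → Odd q → ∀ χ : DirichletCharacter ℂ q,
      χ.IsPrimitive → χ.IsQuadratic → χ.Odd →
        ∀ (K : Type) [Field K] [NumberField K],
          Module.finrank ℚ K = 2 → NumberField.discr K = -(q : ℤ) →
            ∀ (ψ : ClassGroup (𝓞 K) →* ℂˣ) (T : ℝ) (S : Finset ℝ) (t' : ℝ → ℝ),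
              (q : ℝ) ^ (66 : ℕ) ≤ T → Real.exp (Real.log q ^ (2 : ℕ)) ≤ T → IsDyadicPointSet S T →
                (∀ t ∈ S, t' t ≠ t ∧ |t' t - t| ≤ 1) →
                (∑ t ∈ S, ‖(afeA K ψ q (1 / 2 + t * I) - afeA K ψ q (1 / 2 + t' t * I)) /
                    ((t : ℂ) * I - t' t * I)‖ ^ 2 ≤
                  C * (T * Real.log q ^ (7 : ℕ) + T * calL χ T * Real.log T ^ (4 : ℕ))) ∧
                (Real.log T ^ (2 : ℕ) *
                    ∑ t ∈ S, ‖afeA K ψ q (1 / 2 + t * I) - shortLSum K ψ q (1 / 2 + t * I)‖ ^ 2 ≤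
                  C * (T * Real.log q ^ (7 : ℕ) + T * calL χ T * Real.log T ^ (4 : ℕ))) := by
  obtain ⟨C₁, hC₁, h1B⟩ := range1_B_le
  obtain ⟨C₂, hC₂, h2B⟩ := range2_B_le
  obtain ⟨C₃, c₀, hC₃, hc₀, h3B⟩ := range3_B_le h64 hdiv
  obtain ⟨D₁, hD₁, h1A⟩ := range1_A_le
  obtain ⟨D₂, hD₂, h2A⟩ := range2_A_le
  obtain ⟨D₃, c₀', hD₃, hc₀', h3A⟩ := range3_A_le h64 hdiv
  refine ⟨3 * (C₁ + C₂ + C₃) + 3 * (D₁ + D₂ + D₃), by positivity, ?_⟩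
  intro q _ hq hodd χ hprim hquad hχodd K _ _ h2 hdisc ψ T S t' hT hexpT hS ht'
  obtain ⟨hℓ1, -, hLT1, -, hq41, -, hT3, -⟩ := prop81_numerics hq hT hexpT
  have hT0 : 0 < T := by linarith
  have hq4T : ((q ^ 4 : ℕ) : ℝ) ≤ T := by linarith
  have hcalL0 : 0 ≤ calL χ T := calL_nonneg χ (by linarith)
  set X : ℝ := T * Real.log q ^ (7 : ℕ) + T * calL χ T * Real.log T ^ (4 : ℕ) with hX
  have hX0 : 0 ≤ X := by positivity
  have hP1 : 0 ≤ T * Real.log q ^ 7 := by positivity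
  have hP2 : 0 ≤ T * calL χ T * Real.log T ^ 4 := by positivity
  have hX1 : T * Real.log q ^ 7 ≤ X := by rw [hX]; linarith
  have hX2 : T * calL χ T * Real.log T ^ 4 ≤ X := by rw [hX]; linarith
  -- part (i)
  obtain ⟨Θ₁, hΘ₁, hb1⟩ := h1B q hq K χ hprim hquad hχodd h2 hdisc ψ T S t' hT hexpT hS ht'
  obtain ⟨Θ₂, hΘ₂, hb2⟩ := h2B q hq K χ hprim hquad hχodd h2 hdisc ψ T S t' hT hexpT hS ht'
  obtain ⟨Θ₃, hΘ₃, hb3⟩ := h3B q hq hodd K χ hprim hquad hχodd h2 hdisc ψ T S t' hT hexpT hS ht'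
  have hpartB : 1 * ∑ t ∈ S, ‖(afeA K ψ q (1 / 2 + t * I) - afeA K ψ q (1 / 2 + t' t * I)) /
      ((t : ℂ) * I - t' t * I)‖ ^ 2 ≤
      3 * (C₁ * (T * Real.log q ^ 7) + C₂ * (T * calL χ T * Real.log T ^ 4) + C₃ * X) := by
    refine weighted_sum_three_le zero_le_one
      (P₁ := fun t => ‖∑ n ∈ Finset.Icc 1 (q ^ 4),
          (twistCount K (classGroupCharIdealHom ψ) n * (n : ℂ) ^ (-(1 / 2 : ℂ))) *
            ((Θ₁ (Real.log n) : ℂ) * afeOmega q t (t' t) (Real.log n)) * (n : ℂ) ^ (-((t : ℂ) * I))‖ ^ 2)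
      (P₂ := fun t => ‖∑ n ∈ Finset.Icc 1 ⌊2 * T⌋₊,
          (twistCount K (classGroupCharIdealHom ψ) n * (n : ℂ) ^ (-(1 / 2 : ℂ)) *
            (((if q ^ 4 < n then 1 - Real.smoothTransition ((n : ℝ) / T - 1) else 0 : ℝ)) : ℂ)) *
            ((Θ₂ (Real.log n) : ℂ) * afeOmega q t (t' t) (Real.log n)) * (n : ℂ) ^ (-((t : ℂ) * I))‖ ^ 2)
      (P₃ := fun t => ‖∑' n : ℕ, ((tailCutoff c₀ q T n : ℂ) * twistCount K (classGroupCharIdealHom ψ) n *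
            (n : ℂ) ^ (-(1 / 2 : ℂ))) *
          ((Θ₃ (Real.log n) : ℂ) * (afeOmega q t (t' t) (Real.log n) *
            (((1 + Real.exp (Real.log n) / (q * T)) ^ 4 / c₀ : ℝ) : ℂ))) * (n : ℂ) ^ (-((t : ℂ) * I))‖ ^ 2)
      (fun t ht => ?_) (by rw [one_mul]; exact hb1) (by rw [one_mul]; exact hb2) (by rw [one_mul]; exact hb3)
    obtain ⟨-, h2t, -⟩ := point_facts hS hT3 ht (ht' t ht).2
    rw [afeA_dividedDiff_split hq hprim hquad hχodd K h2 hdisc ψ hT0 hq4T hc₀.ne' hΘ₁ hΘ₂ hΘ₃ h2t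
      (ht' t ht).1 (ht' t ht).2]
    set x := ∑ n ∈ Finset.Icc 1 (q ^ 4), (twistCount K (classGroupCharIdealHom ψ) n * (n : ℂ) ^ (-(1 / 2 : ℂ))) *
      ((Θ₁ (Real.log n) : ℂ) * afeOmega q t (t' t) (Real.log n)) * (n : ℂ) ^ (-((t : ℂ) * I))
    set y := ∑ n ∈ Finset.Icc 1 ⌊2 * T⌋₊, (twistCount K (classGroupCharIdealHom ψ) n * (n : ℂ) ^ (-(1 / 2 : ℂ)) *
      (((if q ^ 4 < n then 1 - Real.smoothTransition ((n : ℝ) / T - 1) else 0 : ℝ)) : ℂ)) *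
      ((Θ₂ (Real.log n) : ℂ) * afeOmega q t (t' t) (Real.log n)) * (n : ℂ) ^ (-((t : ℂ) * I))
    set z := ∑' n : ℕ, ((tailCutoff c₀ q T n : ℂ) * twistCount K (classGroupCharIdealHom ψ) n *
        (n : ℂ) ^ (-(1 / 2 : ℂ))) * ((Θ₃ (Real.log n) : ℂ) * (afeOmega q t (t' t) (Real.log n) *
        (((1 + Real.exp (Real.log n) / (q * T)) ^ 4 / c₀ : ℝ) : ℂ))) * (n : ℂ) ^ (-((t : ℂ) * I))
    have h := norm_add₃_le (a := x) (b := y) (c := z)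
    have h0 : 0 ≤ ‖x + y + z‖ := norm_nonneg _
    nlinarith [sq_nonneg (‖x‖ - ‖y‖), sq_nonneg (‖y‖ - ‖z‖), sq_nonneg (‖x‖ - ‖z‖),
      norm_nonneg x, norm_nonneg y, norm_nonneg z]
  -- part (ii)
  obtain ⟨Φ₁, hΦ₁, ha1⟩ := h1A q hq K χ hprim hquad hχodd h2 hdisc ψ T S hT hexpT hS
  obtain ⟨Φ₂, hΦ₂, ha2⟩ := h2A q hq K χ hprim hquad hχodd h2 hdisc ψ T S hT hexpT hS
  obtain ⟨Φ₃, hΦ₃, ha3⟩ := h3A q hq hodd K χ hprim hquad hχodd h2 hdisc ψ T S hT hexpT hS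
  have hpartA : Real.log T ^ (2 : ℕ) *
      ∑ t ∈ S, ‖afeA K ψ q (1 / 2 + t * I) - shortLSum K ψ q (1 / 2 + t * I)‖ ^ 2 ≤
      3 * (D₁ * (T * Real.log q ^ 7) + D₂ * (T * calL χ T * Real.log T ^ 4) + D₃ * X) := by
    refine weighted_sum_three_le (by positivity)
      (P₁ := fun t => ‖∑ n ∈ Finset.Icc 1 (q ^ 4),
          (twistCount K (classGroupCharIdealHom ψ) n * (n : ℂ) ^ (-(1 / 2 : ℂ))) *
            ((Φ₁ (Real.log n) : ℂ) * (afeVlog q (1 / 2 + t * I) (Real.log n) - 1)) *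
            (n : ℂ) ^ (-((t : ℂ) * I))‖ ^ 2)
      (P₂ := fun t => ‖∑ n ∈ Finset.Icc 1 ⌊2 * T⌋₊,
          (twistCount K (classGroupCharIdealHom ψ) n * (n : ℂ) ^ (-(1 / 2 : ℂ)) *
            (((if q ^ 4 < n then 1 - Real.smoothTransition ((n : ℝ) / T - 1) else 0 : ℝ)) : ℂ)) *
            ((Φ₂ (Real.log n) : ℂ) * afeVlog q (1 / 2 + t * I) (Real.log n)) *
            (n : ℂ) ^ (-((t : ℂ) * I))‖ ^ 2)
      (P₃ := fun t => ‖∑' n : ℕ, ((tailCutoff c₀' q T n : ℂ) * twistCount K (classGroupCharIdealHom ψ) n *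
            (n : ℂ) ^ (-(1 / 2 : ℂ))) *
          ((Φ₃ (Real.log n) : ℂ) * (afeVlog q (1 / 2 + t * I) (Real.log n) *
            (((1 + Real.exp (Real.log n) / (q * T)) ^ 4 / c₀' : ℝ) : ℂ))) *
          (n : ℂ) ^ (-((t : ℂ) * I))‖ ^ 2)
      (fun t ht => ?_) ha1 ha2 ha3
    rw [afeA_sub_shortLSum_split hq hprim hquad hχodd K h2 hdisc ψ hT0 hq4T hc₀'.ne' hΦ₁ hΦ₂ hΦ₃
      (by obtain ⟨-, h2t, -⟩ := point_facts hS hT3 ht (t' := t) (by simp); linarith)]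
    set x := ∑ n ∈ Finset.Icc 1 (q ^ 4), (twistCount K (classGroupCharIdealHom ψ) n * (n : ℂ) ^ (-(1 / 2 : ℂ))) *
      ((Φ₁ (Real.log n) : ℂ) * (afeVlog q (1 / 2 + t * I) (Real.log n) - 1)) * (n : ℂ) ^ (-((t : ℂ) * I))
    set y := ∑ n ∈ Finset.Icc 1 ⌊2 * T⌋₊, (twistCount K (classGroupCharIdealHom ψ) n * (n : ℂ) ^ (-(1 / 2 : ℂ)) *
      (((if q ^ 4 < n then 1 - Real.smoothTransition ((n : ℝ) / T - 1) else 0 : ℝ)) : ℂ)) *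
      ((Φ₂ (Real.log n) : ℂ) * afeVlog q (1 / 2 + t * I) (Real.log n)) * (n : ℂ) ^ (-((t : ℂ) * I))
    set z := ∑' n : ℕ, ((tailCutoff c₀' q T n : ℂ) * twistCount K (classGroupCharIdealHom ψ) n *
        (n : ℂ) ^ (-(1 / 2 : ℂ))) * ((Φ₃ (Real.log n) : ℂ) * (afeVlog q (1 / 2 + t * I) (Real.log n) *
        (((1 + Real.exp (Real.log n) / (q * T)) ^ 4 / c₀' : ℝ) : ℂ))) * (n : ℂ) ^ (-((t : ℂ) * I))
    have h := norm_add₃_le (a := x) (b := y) (c := z)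
    have h0 : 0 ≤ ‖x + y + z‖ := norm_nonneg _
    nlinarith [sq_nonneg (‖x‖ - ‖y‖), sq_nonneg (‖y‖ - ‖z‖), sq_nonneg (‖x‖ - ‖z‖),
      norm_nonneg x, norm_nonneg y, norm_nonneg z]
  rw [one_mul] at hpartB
  have e1 : C₁ * (T * Real.log q ^ 7) ≤ C₁ * X := mul_le_mul_of_nonneg_left hX1 hC₁.le
  have e2 : C₂ * (T * calL χ T * Real.log T ^ 4) ≤ C₂ * X := mul_le_mul_of_nonneg_left hX2 hC₂.le
  have e3 : D₁ * (T * Real.log q ^ 7) ≤ D₁ * X := mul_le_mul_of_nonneg_left hX1 hD₁.le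
  have e4 : D₂ * (T * calL χ T * Real.log T ^ 4) ≤ D₂ * X := mul_le_mul_of_nonneg_left hX2 hD₂.le
  have hCX : 0 ≤ (C₁ + C₂ + C₃) * X := by positivity
  have hDX : 0 ≤ (D₁ + D₂ + D₃) * X := by positivity
  have expand : (3 * (C₁ + C₂ + C₃) + 3 * (D₁ + D₂ + D₃)) * X =
      3 * (C₁ * X + C₂ * X + C₃ * X) + 3 * (D₁ * X + D₂ * X + D₃ * X) := by ring
  have hC3 : 0 ≤ 3 * (C₁ * X + C₂ * X + C₃ * X) := by positivity
  have hD3 : 0 ≤ 3 * (D₁ * X + D₂ * X + D₃ * X) := by positivity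
  constructor
  · refine hpartB.trans ?_
    rw [expand]
    linarith only [e1, e2, hD3]
  · refine hpartA.trans ?_
    rw [expand]
    linarith only [e3, e4, hC3]

end ConreyIwaniec2002

end Literature.NumberTheory.LFunctions
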